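import Literature.MathematicalPhysics.QuantumLattice.FermiRG.BGM2006Sec2ShellSupport
import HarnessLib

/-!
# Benfatto–Giuliani–Mastropietro 2006, §2.5: the anisotropic support of `F_{h,ω}` in the moving frame
((2.46)–(2.47)) and the tangential gradient bound (2.53)–(2.54), for the scale-dependent dispersion

Companion proof file of `BGM2006Sec2Setup.lean` (typer-wave file F1a of the cell `gate-hubbard-kl`; source
BGM06 = G. Benfatto, A. Giuliani, V. Mastropietro, *Fermi liquid behavior in the 2D Hubbard model at low
temperatures*, Ann. Henri Poincaré **7** (2006) 809–898, arXiv:cond-mat/0507686; locators `p00NN:Lnn` =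
chunk/line of the `lit read` render of the arXiv TeX).  It supplies the ANISOTROPY-SPECIFIC half of the
proof of Lemma 2.2 (the decay bound (2.52), named fact `BGM2006_Lemma_2_2` of F1a), complementing
`BGM2006Sec2ShellSupport.lean` (the sharp support of `f_h`, the representation (2.49) at general `x`, the
radial localisation and the dimensional bound (2.50)):

* §1–§2 the moving frame (2.47) of a polar curve `θ ↦ u(θ)e⃗_r(θ)`: orthonormality of `n⃗, τ⃗`
  (`polarNormal`, `polarTangent` of F1a), the frame coordinates `k'₁ = k⃗'·n⃗`, `k'₂ = k⃗'·τ⃗` of (2.46),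
  and — for a LEVEL curve `ε(u(θ)e⃗_r(θ)) = lev` — the tangency identity and the formula
  `k⃗'·n⃗(θ) = ∇ε(p⃗)·k⃗' / |∇ε(p⃗)|` (the outgoing normal is the normalised gradient);
* §3 second-order Taylor estimates of a `C²` band along segments (gradient increment, remainder);
* §4 the scale-`h` Fermi curve `p⃗_F^{(h)}(θ) = u_h(θ,0)e⃗_r(θ)`, `u_h(·,0) = levelRadius ε_h μ` of
  Lemma 2.1: a uniform bound on `u_h'` (from tangency and transversality (2.41)) and the chord estimate
  `|p⃗_F^{(h)}(θ) - p⃗_F^{(h)}(θ₀)|₁ ≤ K|θ - θ₀|`;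
* §5 a discrete mean-value estimate on the Matsubara lattice: `|E_h(k₀,q⃗) - E_h(π/β,q⃗)| ≤ 4C₁U²|k₀|`
  and the same for `k⃗`-gradients (from the discrete `k₀`-derivative bounds of (2.36), telescoped), whence
  `|ε_h(q⃗) - μ| ≤ (1 + 32C₁c₀²)e₀γ^h` on the support of `f_h(k₀, ·)` at EVERY scale;
* §6 the polar data of a support point at EVERY scale (`support_polar`), the radial localisation relative
  to THE scale-`h` Fermi curve (`abs_radius_sub_levelRadius_le`: t1's localisation at the frequency-`k₀(j)`
  level curve of `BGM2006Sec2ShellSupport` plus the distance between the two curves along rays), and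
  **the box (2.46)** (`box_of_support`): if `F_{h,ω}(k₀, q⃗) ≠ 0` with `|q⃗| < 3π/4` then, with
  `k⃗' = q⃗ - p⃗_F^{(h)}(θ₀)`, `|k⃗'|₁ ≤ Cγ^h + C'w` (`w` the angular sector width) and
  `|k⃗'·n⃗_h(θ₀)| ≤ (|ε_h(q⃗) - μ| + C|k⃗'|₁²)/(2c'/π)` — BGM p0010:L66: "Using (2.42a) and (2.45) it is easy to
  realize that `|k'₁| ≤ Cγ^h` and `|k'₂| ≤ Cγ^{h/2}` for some constant `C`";
* §7 **the tangential gradient bound (2.53)–(2.54)**: `|∂_{k'₂} ε_h(q⃗)| = |∇ε_h(q⃗)·τ⃗_h(θ₀)| ≤ C|k⃗'|₁`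
  (here from `∇ε_h(p⃗_F)·τ⃗_h(θ₀) = 0` exactly and the Hessian bound, instead of the printed comparison of
  normals at `q⃗`), and `‖∂_{k'₂} E_{h'}(k₀, q⃗)‖ ≤ C|k⃗'|₁ + C'c₀²γ^h` for `h' ∈ {h, h-1}` ((2.53): the
  differences `E_{h'}(k₀,·) - E_{h'}(π/β,·)`, `E_{h'}(π/β,·) - ε_{h'}`, `ε_{h-1} - ε_h` have gradients
  `O(γ^h)` by (2.36)/(2.42)/(2.44), in every direction: `norm_fderiv_slice_sub_fderiv_bgmEffDisp_le`);
* §8 **the package for the anisotropic sectors** (`aniso_support_package`, `n = -h`, `w_n = πγ^{h/2}`):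
  `∃ c₀ > 0, B₁, B₂, B₃` with, for the integration variable `k⃗'` of (2.49): `|k₀| < 8e₀γ^h`,
  `|k⃗'|₁ ≤ B₂γ^{h/2}`, `|k'₁| ≤ B₁γ^h`, `|k'₂| ≤ B₂γ^{h/2}`, `|∂_{k'₂}ε_h| ≤ B₃γ^{h/2}`,
  `‖∂_{k'₂}E_h‖, ‖∂_{k'₂}E_{h-1}‖ ≤ B₃γ^{h/2}` (`γ^h = 4^h`, `γ^{h/2} = 2^h`).

All constants are uniform in `h, ω, β, U` and in the Matsubara frequency; the coupled smallness `c₀`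
(`|U| ≤ c₀`, `|U||h_β| ≤ c₀`, BGM's `c₀ = |h_β|U₀`) is a positive number depending on `μ, e₀` and the
constants `Cₙ` of (2.36) only (`exists_coupledSmallness`, the six constraints of
`BGM2006Sec2ShellSupport.norm_bgmGenProp_le`).  Everything is proved; no definitions, no named facts, no
`sorry`, no instances, no notation.  Downstream use (t1's assembly of (2.52)): integrate by parts along `τ⃗`
with the tangential budget (the higher-order companion of §7) and divide by the box volume of §8.

## Sources

* [BGM06] G. Benfatto, A. Giuliani, V. Mastropietro, Ann. Henri Poincaré 7 (2006) 809–898,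
  arXiv:cond-mat/0507686, §2.5 (2.45)–(2.47), Lemma 2.2 and its proof (2.53)–(2.55), p0010:L20–p0011:L33;
  §2.4 (2.41)–(2.42a). [BenfattoGiulianiMastropietro2006]
* [BGM03] G. Benfatto, A. Giuliani, V. Mastropietro, Ann. Henri Poincaré 4 (2003) 137–193, Lemma 7.3
  (the box for a fixed Fermi curve, cited by BGM06 p0010:L67). [BenfattoGiulianiMastropietro2003]
-/

noncomputable section

open Real Set Filter
open scoped Topology

namespace Literature.MathematicalPhysics.QuantumLattice.FermiRG

/-! ### §1 The moving frame (2.47): orthonormality and the frame coordinates (2.46) -/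

section Frame

/-- `e⃗_t(θ)₁ = -sin θ`. [folklore] -/
@[simp] private theorem dirPerp_zero (θ : ℝ) : dirPerp θ 0 = -Real.sin θ := rfl

/-- `e⃗_t(θ)₂ = cos θ`. [folklore] -/
@[simp] private theorem dirPerp_one (θ : ℝ) : dirPerp θ 1 = Real.cos θ := rfl

/-- The pairing `dot2` is additive in the first slot. [folklore] -/
private theorem dot2_add_left (a b c : Fin 2 → ℝ) : dot2 (a + b) c = dot2 a c + dot2 b c := by
  simp only [dot2, Pi.add_apply]; ring

/-- The pairing `dot2` is additive in the second slot. [folklore] -/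
private theorem dot2_add_right (a b c : Fin 2 → ℝ) : dot2 a (b + c) = dot2 a b + dot2 a c := by
  simp only [dot2, Pi.add_apply]; ring

/-- `(s v⃗)·w⃗ = s (v⃗·w⃗)`. [folklore] -/
private theorem dot2_smul_left (s : ℝ) (a b : Fin 2 → ℝ) : dot2 (s • a) b = s * dot2 a b := by
  simp only [dot2, Pi.smul_apply, smul_eq_mul]; ring

/-- `v⃗·(s w⃗) = s (v⃗·w⃗)`. [folklore] -/
private theorem dot2_smul_right (s : ℝ) (a b : Fin 2 → ℝ) : dot2 a (s • b) = s * dot2 a b := by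
  simp only [dot2, Pi.smul_apply, smul_eq_mul]; ring

/-- `v⃗·(w⃗ - w⃗') = v⃗·w⃗ - v⃗·w⃗'`. [folklore] -/
private theorem dot2_sub_left (a b c : Fin 2 → ℝ) : dot2 (a - b) c = dot2 a c - dot2 b c := by
  simp only [dot2, Pi.sub_apply]; ring

/-- `|v⃗·w⃗| ≤ (|v₁| + |v₂|) max|wᵢ|`, in the form used for unit vectors: `|wᵢ| ≤ 1 ⟹ |v⃗·w⃗| ≤ |v₁| + |v₂|`.
[folklore] -/
private theorem abs_dot2_le_of_abs_le_one {v w : Fin 2 → ℝ} (h0 : |w 0| ≤ 1) (h1 : |w 1| ≤ 1) :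
    |dot2 v w| ≤ |v 0| + |v 1| := by
  unfold dot2
  calc |v 0 * w 0 + v 1 * w 1| ≤ |v 0 * w 0| + |v 1 * w 1| := abs_add_le _ _
    _ = |v 0| * |w 0| + |v 1| * |w 1| := by rw [abs_mul, abs_mul]
    _ ≤ |v 0| * 1 + |v 1| * 1 := by gcongr
    _ = |v 0| + |v 1| := by ring

/-- A linear form on `ℝ²` through the polar frame: `L v⃗ = (v⃗·e⃗_r) L e⃗_r + (v⃗·e⃗_t) L e⃗_t`. [folklore] -/
private theorem clm_apply_eq_dot2_frame (L : (Fin 2 → ℝ) →L[ℝ] ℝ) (θ : ℝ) (v : Fin 2 → ℝ) :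
    L v = dot2 v (dir θ) * L (dir θ) + dot2 v (dirPerp θ) * L (dirPerp θ) := by
  have hv : v = dot2 v (dir θ) • dir θ + dot2 v (dirPerp θ) • dirPerp θ := by
    have hcs := Real.sin_sq_add_cos_sq θ
    ext i
    fin_cases i
    · simp only [dot2, dir_zero, dir_one, dirPerp_zero, dirPerp_one, Fin.zero_eta, Pi.add_apply,
        Pi.smul_apply, smul_eq_mul]
      linear_combination (-(v 0)) * hcs
    · simp only [dot2, dir_zero, dir_one, dirPerp_zero, dirPerp_one, Fin.mk_one, Pi.add_apply,
        Pi.smul_apply, smul_eq_mul]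
      linear_combination (-(v 1)) * hcs
  conv_lhs => rw [hv]
  rw [map_add, map_smul, map_smul, smul_eq_mul, smul_eq_mul]

/-- `a² + b² = 1 ⟹ |a| ≤ 1 ∧ |b| ≤ 1`. [folklore] -/
private theorem abs_le_one_of_sq_add_sq_eq_one {a b : ℝ} (h : a ^ 2 + b ^ 2 = 1) : |a| ≤ 1 ∧ |b| ≤ 1 := by
  constructor
  · rw [abs_le_one_iff_mul_self_le_one]; nlinarith [sq_nonneg b]
  · rw [abs_le_one_iff_mul_self_le_one]; nlinarith [sq_nonneg a]

variable (u : ℝ → ℝ) (θ : ℝ)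

/-- `√(u² + u'²)² = u² + u'²`. [folklore] -/
private theorem polarSpeed_sq : polarSpeed u θ ^ 2 = u θ ^ 2 + deriv u θ ^ 2 :=
  Real.sq_sqrt (by positivity)

/-- `√(u² + u'²) > 0` as soon as `u(θ) > 0`. [folklore] -/
private theorem polarSpeed_pos (hu : 0 < u θ) : 0 < polarSpeed u θ :=
  Real.sqrt_pos.2 (by nlinarith [sq_nonneg (deriv u θ)])

/-- `S⁻² (u² + u'²) = 1` for `S = √(u² + u'²) > 0`. [folklore] -/
private theorem polarSpeed_inv_sq_mul (hu : 0 < u θ) :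
    (polarSpeed u θ)⁻¹ ^ 2 * (u θ ^ 2 + deriv u θ ^ 2) = 1 := by
  rw [← polarSpeed_sq, inv_pow, inv_mul_cancel₀ (pow_ne_zero 2 (polarSpeed_pos u θ hu).ne')]

/-- **Orthonormal frame coordinates (2.46)**: `(v⃗·n⃗)² + (v⃗·τ⃗)² = v₁² + v₂²` for the frame (2.47) of a
polar curve with `u(θ) > 0`. [cite: BenfattoGiulianiMastropietro2006, §2.5 (2.46)–(2.47) p0010:L55–L64] -/
theorem dot2_polarNormal_sq_add_dot2_polarTangent_sq (hu : 0 < u θ) (v : Fin 2 → ℝ) :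
    dot2 v (polarNormal u θ) ^ 2 + dot2 v (polarTangent u θ) ^ 2 = v 0 ^ 2 + v 1 ^ 2 := by
  have ht := polarSpeed_inv_sq_mul u θ hu
  have hcs := Real.sin_sq_add_cos_sq θ
  simp only [dot2, polarNormal, polarTangent, Pi.smul_apply, Pi.add_apply, Pi.sub_apply, smul_eq_mul,
    dir_zero, dir_one, dirPerp_zero, dirPerp_one]
  linear_combination (v 0 ^ 2 + v 1 ^ 2) * (Real.sin θ ^ 2 + Real.cos θ ^ 2) * ht + (v 0 ^ 2 + v 1 ^ 2) * hcs

/-- `τ₁² + τ₂² = 1`. [cite: BenfattoGiulianiMastropietro2006, §2.5 (2.47) p0010:L60] -/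
theorem polarTangent_sq_add_sq (hu : 0 < u θ) : polarTangent u θ 0 ^ 2 + polarTangent u θ 1 ^ 2 = 1 := by
  have ht := polarSpeed_inv_sq_mul u θ hu
  have hcs := Real.sin_sq_add_cos_sq θ
  simp only [polarTangent, Pi.smul_apply, Pi.add_apply, smul_eq_mul, dir_zero, dir_one, dirPerp_zero,
    dirPerp_one]
  linear_combination (Real.sin θ ^ 2 + Real.cos θ ^ 2) * ht + hcs

/-- `n₁² + n₂² = 1`. [cite: BenfattoGiulianiMastropietro2006, §2.5 (2.47) p0010:L62] -/
theorem polarNormal_sq_add_sq (hu : 0 < u θ) : polarNormal u θ 0 ^ 2 + polarNormal u θ 1 ^ 2 = 1 := by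
  have ht := polarSpeed_inv_sq_mul u θ hu
  have hcs := Real.sin_sq_add_cos_sq θ
  simp only [polarNormal, Pi.smul_apply, Pi.sub_apply, smul_eq_mul, dir_zero, dir_one, dirPerp_zero,
    dirPerp_one]
  linear_combination (Real.sin θ ^ 2 + Real.cos θ ^ 2) * ht + hcs

/-- The tangent vector (2.47) has components of modulus `≤ 1`. [cite: BenfattoGiulianiMastropietro2006, §2.5 (2.47) p0010:L60] -/
theorem abs_polarTangent_apply_le_one (hu : 0 < u θ) (i : Fin 2) : |polarTangent u θ i| ≤ 1 := by
  obtain ⟨h0, h1⟩ := abs_le_one_of_sq_add_sq_eq_one (polarTangent_sq_add_sq u θ hu)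
  fin_cases i
  · exact h0
  · exact h1

/-- The normal vector (2.47) has components of modulus `≤ 1`. [cite: BenfattoGiulianiMastropietro2006, §2.5 (2.47) p0010:L62] -/
theorem abs_polarNormal_apply_le_one (hu : 0 < u θ) (i : Fin 2) : |polarNormal u θ i| ≤ 1 := by
  obtain ⟨h0, h1⟩ := abs_le_one_of_sq_add_sq_eq_one (polarNormal_sq_add_sq u θ hu)
  fin_cases i
  · exact h0
  · exact h1

/-- **`|k'₂| = |k⃗'·τ⃗| ≤ |k'|₁`.** [cite: BenfattoGiulianiMastropietro2006, §2.5 (2.46) p0010:L55] -/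
theorem abs_dot2_polarTangent_le (hu : 0 < u θ) (v : Fin 2 → ℝ) :
    |dot2 v (polarTangent u θ)| ≤ |v 0| + |v 1| :=
  abs_dot2_le_of_abs_le_one (abs_polarTangent_apply_le_one u θ hu 0) (abs_polarTangent_apply_le_one u θ hu 1)

/-- **`|k'₁| = |k⃗'·n⃗| ≤ |k'|₁`.** [cite: BenfattoGiulianiMastropietro2006, §2.5 (2.46) p0010:L55] -/
theorem abs_dot2_polarNormal_le (hu : 0 < u θ) (v : Fin 2 → ℝ) :
    |dot2 v (polarNormal u θ)| ≤ |v 0| + |v 1| :=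
  abs_dot2_le_of_abs_le_one (abs_polarNormal_apply_le_one u θ hu 0) (abs_polarNormal_apply_le_one u θ hu 1)

/-- **The outgoing normal of a level curve is the normalised gradient.**  If `u(θ) > 0` and the frame
numbers `a = ∇ε(p⃗)·e⃗_r > 0`, `b = ∇ε(p⃗)·e⃗_t` satisfy the tangency relation `u'a + u b = 0` (§2), then
`v⃗·n⃗(θ) = (a v⃗·e⃗_r + b v⃗·e⃗_t)/√(a² + b²)` for every `v⃗` — BGM: "`∇ε_h(k⃗) = |∇ε_h(k⃗)| n⃗_h(θ, e)`
where … `n⃗_h(θ,e)` is the outgoing normal vector at `Σ^{(h)}(e)` in `k⃗`". [cite: BenfattoGiulianiMastropietro2006, §2.5 proof of Lemma 2.2 (2.54) p0010:L147–L151] -/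
theorem dot2_polarNormal_eq_of_tangency {a b : ℝ} (hu : 0 < u θ) (ha : 0 < a)
    (htan : deriv u θ * a + u θ * b = 0) (v : Fin 2 → ℝ) :
    dot2 v (polarNormal u θ) = (a * dot2 v (dir θ) + b * dot2 v (dirPerp θ)) / Real.sqrt (a ^ 2 + b ^ 2) := by
  have hR : 0 < Real.sqrt (a ^ 2 + b ^ 2) := Real.sqrt_pos.2 (by positivity)
  have hR2 : Real.sqrt (a ^ 2 + b ^ 2) ^ 2 = a ^ 2 + b ^ 2 := Real.sq_sqrt (by positivity)
  have hu' : deriv u θ = -(u θ * b) / a := by field_simp; linarith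
  -- `√(u² + u'²) = (u/a)√(a² + b²)`
  have hS : polarSpeed u θ = u θ / a * Real.sqrt (a ^ 2 + b ^ 2) := by
    have hnn : 0 ≤ u θ / a * Real.sqrt (a ^ 2 + b ^ 2) := by positivity
    have hsq : u θ ^ 2 + deriv u θ ^ 2 = (u θ / a * Real.sqrt (a ^ 2 + b ^ 2)) ^ 2 := by
      rw [mul_pow, hR2, hu']; field_simp
    rw [polarSpeed, hsq, Real.sqrt_sq hnn]
  simp only [dot2, polarNormal, Pi.smul_apply, Pi.sub_apply, smul_eq_mul, dir_zero, dir_one,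
    dirPerp_zero, dirPerp_one, hS, hu']
  have hune : u θ ≠ 0 := hu.ne'
  field_simp
  ring

end Frame

/-! ### §2 Tangency along a level curve -/

section Tangency

variable {ε : (Fin 2 → ℝ) → ℝ} {u : ℝ → ℝ} {lev : ℝ}

/-- The velocity of the polar curve `θ ↦ u(θ)e⃗_r(θ)` at a point of differentiability: `u'e⃗_r + u e⃗_t`. [folklore] -/
private theorem hasDerivAt_polarCurve' {θ : ℝ} (hu : DifferentiableAt ℝ u θ) :
    HasDerivAt (fun ϑ => u ϑ • dir ϑ) (deriv u θ • dir θ + u θ • dirPerp θ) θ := by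
  have h := hu.hasDerivAt.smul (hasDerivAt_dir θ)
  rw [add_comm] at h
  exact h

/-- **Tangency** `u'(θ)·(∇ε·e⃗_r) + u(θ)·(∇ε·e⃗_t) = 0` along a level curve `ε(u(ϑ)e⃗_r(ϑ)) = lev`
(chain rule; BGM differentiate the identity `ε_h(u_h(θ,e)e⃗_r(θ)) - μ = e` in the proof of Lemma 2.1).
[cite: BenfattoGiulianiMastropietro2006, §2.4 proof of Lemma 2.1 p0009:L85–L95] -/
theorem tangency_of_level (hε : Differentiable ℝ ε) {θ : ℝ} (hu : DifferentiableAt ℝ u θ)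
    (hlevel : ∀ ϑ, ε (u ϑ • dir ϑ) = lev) :
    deriv u θ * fderiv ℝ ε (u θ • dir θ) (dir θ) + u θ * fderiv ℝ ε (u θ • dir θ) (dirPerp θ) = 0 := by
  have hφ : HasDerivAt (fun ϑ => ε (u ϑ • dir ϑ))
      (fderiv ℝ ε (u θ • dir θ) (deriv u θ • dir θ + u θ • dirPerp θ)) θ :=
    (hε (u θ • dir θ)).hasFDerivAt.comp_hasDerivAt θ (hasDerivAt_polarCurve' hu)
  have hφ0 : HasDerivAt (fun ϑ => ε (u ϑ • dir ϑ)) 0 θ := by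
    rw [show (fun ϑ => ε (u ϑ • dir ϑ)) = fun _ => lev from funext hlevel]
    exact hasDerivAt_const θ lev
  have h := hφ.unique hφ0
  rwa [map_add, map_smul, map_smul, smul_eq_mul, smul_eq_mul] at h

/-- **`∇ε(p⃗)·τ⃗ = 0` at `p⃗ = u(θ)e⃗_r(θ)`**: the tangent (2.47) of a level curve is orthogonal to the
gradient. [cite: BenfattoGiulianiMastropietro2006, §2.5 (2.47), (2.54) p0010:L58–L64, L147] -/
theorem fderiv_polarTangent_eq_zero (hε : Differentiable ℝ ε) {θ : ℝ} (hu : DifferentiableAt ℝ u θ)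
    (hlevel : ∀ ϑ, ε (u ϑ • dir ϑ) = lev) :
    fderiv ℝ ε (u θ • dir θ) (polarTangent u θ) = 0 := by
  have h := tangency_of_level hε hu hlevel
  rw [polarTangent, map_smul, map_add, map_smul, map_smul, smul_eq_mul, smul_eq_mul, smul_eq_mul, h,
    mul_zero]

/-- **The normal coordinate through the gradient**: along a level curve with `u(θ) > 0` and radial
transversality `a = ∇ε(p⃗)·e⃗_r > 0` ((2.41)), `v⃗·n⃗(θ) = ∇ε(p⃗)·v⃗ / √(a² + b²)`, `b = ∇ε(p⃗)·e⃗_t`,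
`p⃗ = u(θ)e⃗_r(θ)`. [cite: BenfattoGiulianiMastropietro2006, §2.5 proof of Lemma 2.2 (2.54) p0010:L147–L151] -/
theorem dot2_polarNormal_eq_fderiv_div (hε : Differentiable ℝ ε) {θ : ℝ} (hu : DifferentiableAt ℝ u θ)
    (hlevel : ∀ ϑ, ε (u ϑ • dir ϑ) = lev) (hupos : 0 < u θ) (ha : 0 < fderiv ℝ ε (u θ • dir θ) (dir θ))
    (v : Fin 2 → ℝ) :
    dot2 v (polarNormal u θ) = fderiv ℝ ε (u θ • dir θ) v /
      Real.sqrt (fderiv ℝ ε (u θ • dir θ) (dir θ) ^ 2 + fderiv ℝ ε (u θ • dir θ) (dirPerp θ) ^ 2) := by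
  rw [dot2_polarNormal_eq_of_tangency u θ hupos ha (tangency_of_level hε hu hlevel) v,
    clm_apply_eq_dot2_frame (fderiv ℝ ε (u θ • dir θ)) θ v]
  ring_nf

/-- Hence **`|v⃗·n⃗(θ)| ≤ |∇ε(p⃗)·v⃗| / a`** (`√(a² + b²) ≥ a`). [cite: BenfattoGiulianiMastropietro2006, §2.5 proof of Lemma 2.2 (2.54) p0010:L147–L151] -/
theorem abs_dot2_polarNormal_le_of_level (hε : Differentiable ℝ ε) {θ : ℝ} (hu : DifferentiableAt ℝ u θ)
    (hlevel : ∀ ϑ, ε (u ϑ • dir ϑ) = lev) (hupos : 0 < u θ) (ha : 0 < fderiv ℝ ε (u θ • dir θ) (dir θ))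
    (v : Fin 2 → ℝ) :
    |dot2 v (polarNormal u θ)| ≤ |fderiv ℝ ε (u θ • dir θ) v| / fderiv ℝ ε (u θ • dir θ) (dir θ) := by
  rw [dot2_polarNormal_eq_fderiv_div hε hu hlevel hupos ha v, abs_div,
    abs_of_pos (Real.sqrt_pos.2 (by positivity))]
  refine div_le_div_of_nonneg_left (abs_nonneg _) ha ?_
  calc fderiv ℝ ε (u θ • dir θ) (dir θ) = Real.sqrt (fderiv ℝ ε (u θ • dir θ) (dir θ) ^ 2) :=
        (Real.sqrt_sq ha.le).symm
    _ ≤ _ := Real.sqrt_le_sqrt (by nlinarith)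

end Tangency

/-! ### §3 Second-order estimates of a `C²` band along segments -/

section Taylor

variable {ε : (Fin 2 → ℝ) → ℝ} {δ₁ δ₂ : ℝ}

/-- `|cos θ| + |sin θ|`-type bound: `|e⃗_r(θ)₁| + |e⃗_r(θ)₂| ≤ 2`. [folklore] -/
private theorem abs_dir_apply_add_le_two (θ : ℝ) : |dir θ 0| + |dir θ 1| ≤ 2 := by
  have := Real.abs_cos_le_one θ; have := Real.abs_sin_le_one θ
  simp only [dir_zero, dir_one]; linarith

/-- `|e⃗_t(θ)₁| + |e⃗_t(θ)₂| ≤ 2`. [folklore] -/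
private theorem abs_dirPerp_apply_add_le_two (θ : ℝ) : |dirPerp θ 0| + |dirPerp θ 1| ≤ 2 := by
  have := Real.abs_cos_le_one θ; have := Real.abs_sin_le_one θ
  simp only [dirPerp_zero, dirPerp_one, abs_neg]; linarith

/-- **Gradient bound of the perturbed band**: `|∇ε(k⃗)·v⃗| ≤ (2 + δ₁)(|v₁| + |v₂|)` when
`|∇(ε - ε₀)·v⃗| ≤ δ₁(|v₁| + |v₂|)` (`∇ε₀(k⃗)·v⃗ = 2 sin k₁ v₁ + 2 sin k₂ v₂`). [cite: BenfattoGiulianiMastropietro2006, §2.4 (2.41a) p0009:L77–L84] -/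
theorem abs_fderiv_le_of_close
    (h1 : ∀ k v, |fderiv ℝ ε k v - fderiv ℝ sqDispersion k v| ≤ δ₁ * (|v 0| + |v 1|))
    (k v : Fin 2 → ℝ) : |fderiv ℝ ε k v| ≤ (2 + δ₁) * (|v 0| + |v 1|) := by
  have h := h1 k v
  have hfree : |fderiv ℝ sqDispersion k v| ≤ 2 * (|v 0| + |v 1|) := by
    rw [fderiv_sqDispersion_apply]
    have hs0 := Real.abs_sin_le_one (k 0)
    have hs1 := Real.abs_sin_le_one (k 1)
    calc |2 * Real.sin (k 0) * v 0 + 2 * Real.sin (k 1) * v 1|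
        ≤ |2 * Real.sin (k 0) * v 0| + |2 * Real.sin (k 1) * v 1| := abs_add_le _ _
      _ = 2 * (|Real.sin (k 0)| * |v 0|) + 2 * (|Real.sin (k 1)| * |v 1|) := by
          simp only [abs_mul, abs_two]; ring
      _ ≤ 2 * (1 * |v 0|) + 2 * (1 * |v 1|) := by gcongr
      _ = 2 * (|v 0| + |v 1|) := by ring
  have := abs_sub_abs_le_abs_sub (fderiv ℝ ε k v) (fderiv ℝ sqDispersion k v)
  linarith

/-- **Hessian bound of the perturbed band**: `|D²ε(k⃗)(v⃗, w⃗)| ≤ (2 + δ₂)(|v₁| + |v₂|)(|w₁| + |w₂|)` when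
`|D²(ε - ε₀)(v⃗,w⃗)| ≤ δ₂(|v₁| + |v₂|)(|w₁| + |w₂|)` (`D²ε₀ = 2 diag(cos k₁, cos k₂)`). [cite: BenfattoGiulianiMastropietro2006, §2.4 (2.41a) p0009:L77–L84] -/
theorem abs_fderiv_fderiv_le_of_close
    (h2 : ∀ k v w, |fderiv ℝ (fderiv ℝ ε) k v w - fderiv ℝ (fderiv ℝ sqDispersion) k v w| ≤
      δ₂ * (|v 0| + |v 1|) * (|w 0| + |w 1|))
    (k v w : Fin 2 → ℝ) : |fderiv ℝ (fderiv ℝ ε) k v w| ≤ (2 + δ₂) * (|v 0| + |v 1|) * (|w 0| + |w 1|) := by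
  have h := h2 k v w
  have hfree : |fderiv ℝ (fderiv ℝ sqDispersion) k v w| ≤ 2 * (|v 0| + |v 1|) * (|w 0| + |w 1|) := by
    rw [fderiv_fderiv_sqDispersion_apply]
    have hc0 := Real.abs_cos_le_one (k 0)
    have hc1 := Real.abs_cos_le_one (k 1)
    calc |2 * (Real.cos (k 0) * v 0 * w 0 + Real.cos (k 1) * v 1 * w 1)|
        = 2 * |Real.cos (k 0) * v 0 * w 0 + Real.cos (k 1) * v 1 * w 1| := by
          rw [abs_mul, abs_two]
      _ ≤ 2 * (|Real.cos (k 0) * v 0 * w 0| + |Real.cos (k 1) * v 1 * w 1|) := by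
          gcongr; exact abs_add_le _ _
      _ = 2 * (|Real.cos (k 0)| * (|v 0| * |w 0|)) + 2 * (|Real.cos (k 1)| * (|v 1| * |w 1|)) := by
          simp only [abs_mul]; ring
      _ ≤ 2 * (1 * (|v 0| * |w 0|)) + 2 * (1 * (|v 1| * |w 1|)) := by gcongr
      _ ≤ 2 * (|v 0| + |v 1|) * (|w 0| + |w 1|) := by
          nlinarith [abs_nonneg (v 0), abs_nonneg (v 1), abs_nonneg (w 0), abs_nonneg (w 1)]
  have := abs_sub_abs_le_abs_sub (fderiv ℝ (fderiv ℝ ε) k v w) (fderiv ℝ (fderiv ℝ sqDispersion) k v w)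
  linarith

/-- The derivative of `s ↦ ∇ε(p⃗ + s w⃗)·v⃗` is `D²ε(p⃗ + s w⃗)(w⃗, v⃗)`. [folklore] -/
private theorem hasDerivAt_fderiv_segment (hε : ContDiff ℝ 2 ε) (p w v : Fin 2 → ℝ) (s : ℝ) :
    HasDerivAt (fun s : ℝ => fderiv ℝ ε (p + s • w) v) (fderiv ℝ (fderiv ℝ ε) (p + s • w) w v) s := by
  have hd : Differentiable ℝ (fderiv ℝ ε) :=
    (hε.fderiv_right (m := 1) (by norm_num)).differentiable (by simp)
  have hl : HasDerivAt (fun s : ℝ => p + s • w) w s := by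
    simpa using ((hasDerivAt_id s).smul_const w).const_add p
  have h1 : HasDerivAt (fun s : ℝ => fderiv ℝ ε (p + s • w)) (fderiv ℝ (fderiv ℝ ε) (p + s • w) w) s :=
    (hd (p + s • w)).hasFDerivAt.comp_hasDerivAt s hl
  have h2 := h1.clm_apply (hasDerivAt_const s v)
  simpa using h2

/-- **Gradient increment along a segment**: `|∇ε(q⃗)·v⃗ - ∇ε(p⃗)·v⃗| ≤ (2 + δ₂)|q⃗ - p⃗|₁(|v₁| + |v₂|)`.
[cite: BenfattoGiulianiMastropietro2006, §2.5 proof of Lemma 2.2 (2.53)–(2.54) p0010:L140–L154] -/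
theorem abs_fderiv_sub_fderiv_le (hε : ContDiff ℝ 2 ε)
    (h2 : ∀ k v w, |fderiv ℝ (fderiv ℝ ε) k v w - fderiv ℝ (fderiv ℝ sqDispersion) k v w| ≤
      δ₂ * (|v 0| + |v 1|) * (|w 0| + |w 1|))
    (p q v : Fin 2 → ℝ) :
    |fderiv ℝ ε q v - fderiv ℝ ε p v| ≤ (2 + δ₂) * (|(q - p) 0| + |(q - p) 1|) * (|v 0| + |v 1|) := by
  set w := q - p with hw
  have h := Convex.norm_image_sub_le_of_norm_hasDerivWithin_le (s := Icc (0 : ℝ) 1)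
    (f := fun s : ℝ => fderiv ℝ ε (p + s • w) v)
    (f' := fun s => fderiv ℝ (fderiv ℝ ε) (p + s • w) w v)
    (C := (2 + δ₂) * (|w 0| + |w 1|) * (|v 0| + |v 1|))
    (fun s _ => (hasDerivAt_fderiv_segment hε p w v s).hasDerivWithinAt)
    (fun s _ => by rw [Real.norm_eq_abs]; exact abs_fderiv_fderiv_le_of_close h2 _ _ _)
    (convex_Icc 0 1) (left_mem_Icc.2 zero_le_one) (right_mem_Icc.2 zero_le_one)
  simp only [zero_smul, add_zero, one_smul, Real.norm_eq_abs, sub_zero, abs_one, mul_one] at h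
  have hq : p + w = q := by rw [hw]; abel
  rw [hq] at h
  exact h

/-- **Second-order Taylor remainder along a segment**:
`|ε(q⃗) - ε(p⃗) - ∇ε(p⃗)·(q⃗ - p⃗)| ≤ (2 + δ₂)|q⃗ - p⃗|₁²`. [cite: BenfattoGiulianiMastropietro2006, §2.5 proof of Lemma 2.2 p0010:L140–L154] -/
theorem abs_taylor_two_le (hε : ContDiff ℝ 2 ε)
    (h2 : ∀ k v w, |fderiv ℝ (fderiv ℝ ε) k v w - fderiv ℝ (fderiv ℝ sqDispersion) k v w| ≤
      δ₂ * (|v 0| + |v 1|) * (|w 0| + |w 1|))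
    (p q : Fin 2 → ℝ) :
    |ε q - ε p - fderiv ℝ ε p (q - p)| ≤ (2 + δ₂) * (|(q - p) 0| + |(q - p) 1|) ^ 2 := by
  set w := q - p with hw
  have hεd : Differentiable ℝ ε := hε.differentiable (by simp)
  -- `g(s) = ε(p + s w) - s ∇ε(p)·w`, `g' = ∇ε(p + s w)·w - ∇ε(p)·w`
  have hg : ∀ s : ℝ, HasDerivAt (fun s : ℝ => ε (p + s • w) - s * fderiv ℝ ε p w)
      (fderiv ℝ ε (p + s • w) w - fderiv ℝ ε p w) s := by
    intro s
    have hl : HasDerivAt (fun s : ℝ => p + s • w) w s := by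
      simpa using ((hasDerivAt_id s).smul_const w).const_add p
    have h1 : HasDerivAt (fun s : ℝ => ε (p + s • w)) (fderiv ℝ ε (p + s • w) w) s :=
      (hεd (p + s • w)).hasFDerivAt.comp_hasDerivAt s hl
    have h2' : HasDerivAt (fun s : ℝ => s * fderiv ℝ ε p w) (fderiv ℝ ε p w) s := by
      simpa using (hasDerivAt_id s).mul_const (fderiv ℝ ε p w)
    exact h1.sub h2'
  have hbound : ∀ s ∈ Icc (0 : ℝ) 1, ‖fderiv ℝ ε (p + s • w) w - fderiv ℝ ε p w‖ ≤ (2 + δ₂) * (|w 0| + |w 1|) ^ 2 := by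
    intro s hs
    rw [Real.norm_eq_abs]
    have h := abs_fderiv_sub_fderiv_le hε h2 p (p + s • w) w
    simp only [add_sub_cancel_left, Pi.smul_apply, smul_eq_mul, abs_mul, abs_of_nonneg hs.1] at h
    have hδ : 0 ≤ 2 + δ₂ := by
      have h0 := abs_fderiv_fderiv_le_of_close h2 0 (Pi.single 0 1) (Pi.single 0 1)
      have : (0 : ℝ) ≤ (2 + δ₂) * (|(Pi.single 0 1 : Fin 2 → ℝ) 0| + |(Pi.single 0 1 : Fin 2 → ℝ) 1|) *
          (|(Pi.single 0 1 : Fin 2 → ℝ) 0| + |(Pi.single 0 1 : Fin 2 → ℝ) 1|) := (abs_nonneg _).trans h0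
      simpa using this
    have hS : 0 ≤ |w 0| + |w 1| := by positivity
    calc _ ≤ (2 + δ₂) * (s * |w 0| + s * |w 1|) * (|w 0| + |w 1|) := h
      _ = s * ((2 + δ₂) * (|w 0| + |w 1|) ^ 2) := by ring
      _ ≤ 1 * ((2 + δ₂) * (|w 0| + |w 1|) ^ 2) := mul_le_mul_of_nonneg_right hs.2 (by positivity)
      _ = _ := one_mul _
  have h := Convex.norm_image_sub_le_of_norm_hasDerivWithin_le (s := Icc (0 : ℝ) 1)
    (fun s _ => (hg s).hasDerivWithinAt) hbound (convex_Icc 0 1) (left_mem_Icc.2 zero_le_one)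
    (right_mem_Icc.2 zero_le_one)
  simp only [zero_smul, add_zero, one_smul, zero_mul, sub_zero, one_mul, Real.norm_eq_abs, abs_one,
    mul_one] at h
  have hq : p + w = q := by rw [hw]; abel
  rw [hq] at h
  have e : ε q - fderiv ℝ ε p w - ε p = ε q - ε p - fderiv ℝ ε p w := by ring
  rw [e] at h
  exact h

end Taylor

/-! ### §4 The scale-`h` Fermi curve: derivative bound and chord estimate for the polar radius -/

section Curve

variable {ε : (Fin 2 → ℝ) → ℝ} {δ₀ δ₁ c lev : ℝ}

/-- **A uniform bound on `u'`** for the polar radius `u = levelRadius ε lev` of a `C²` band `C¹`-close to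
`ε₀` at an admissible level: from tangency `u'(∇ε·e⃗_r) = -u(∇ε·e⃗_t)`, transversality
`∇ε·e⃗_r ≥ 4c/π - 2δ₁` ((2.41)) and `|∇ε·e⃗_t| ≤ 2(2 + δ₁)`, `u ≤ π/2`:
`|u'(θ)| ≤ π(2 + δ₁)/(4c/π - 2δ₁)`. [cite: BenfattoGiulianiMastropietro2006, §2.4 Lemma 2.1 (1)–(2) (2.40)–(2.41) p0009:L39–L60] -/
theorem abs_deriv_levelRadius_le (hε : ContDiff ℝ 2 ε) (h0 : ∀ k, |ε k - sqDispersion k| ≤ δ₀)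
    (h1 : ∀ k v, |fderiv ℝ ε k v - fderiv ℝ sqDispersion k v| ≤ δ₁ * (|v 0| + |v 1|)) (hδ₁ : 0 ≤ δ₁)
    (hc : 2 * δ₁ < 4 / π * c) (hlev : lev ∈ Ioo (c ^ 2 + δ₀ - 4) (-2 - Real.sqrt 2 - δ₀)) (θ : ℝ) :
    |deriv (levelRadius ε lev) θ| ≤ π * (2 + δ₁) / (4 / π * c - 2 * δ₁) := by
  have hεd : Differentiable ℝ ε := hε.differentiable (by simp)
  obtain ⟨hroot, hcu, -, -⟩ := levelRadius_bounds hε h0 hδ₁ hc hlev θ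
  have hud : DifferentiableAt ℝ (levelRadius ε lev) θ :=
    ((contDiff_levelRadius hε le_rfl h0 h1 hδ₁ hc hlev).differentiable (by simp)) θ
  have hlevel : ∀ ϑ, ε (levelRadius ε lev ϑ • dir ϑ) = lev := fun ϑ =>
    (levelRadius_bounds hε h0 hδ₁ hc hlev ϑ).1.2
  have htan := tangency_of_level hεd hud hlevel
  set u := levelRadius ε lev θ with hu
  set a := fderiv ℝ ε (u • dir θ) (dir θ) with ha
  set b := fderiv ℝ ε (u • dir θ) (dirPerp θ) with hb
  have hm : 0 < 4 / π * c - 2 * δ₁ := by linarith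
  have ha' : 4 / π * c - 2 * δ₁ ≤ a := by
    have h := fderiv_ray_dir_ge' h1 hδ₁ hroot.1.1 hroot.1.2 θ
    have : 4 / π * c ≤ 4 / π * u := mul_le_mul_of_nonneg_left hcu (by positivity)
    linarith
  have hapos : 0 < a := lt_of_lt_of_le hm ha'
  have hb' : |b| ≤ 2 * (2 + δ₁) := by
    have h := abs_fderiv_le_of_close h1 (u • dir θ) (dirPerp θ)
    have h2 := abs_dirPerp_apply_add_le_two θ
    have hδ : 0 ≤ 2 + δ₁ := by linarith
    calc |b| ≤ (2 + δ₁) * (|dirPerp θ 0| + |dirPerp θ 1|) := h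
      _ ≤ (2 + δ₁) * 2 := mul_le_mul_of_nonneg_left h2 hδ
      _ = 2 * (2 + δ₁) := by ring
  have hu2 : |u| ≤ π / 2 := by rw [abs_of_nonneg hroot.1.1]; exact hroot.1.2
  -- `|u'| a = |u| |b|`
  have hkey : |deriv (levelRadius ε lev) θ| * a = |u| * |b| := by
    have e : deriv (levelRadius ε lev) θ * a = -(u * b) := by linarith
    have := congrArg (fun x => |x|) e
    simp only [abs_mul, abs_neg, abs_of_pos hapos] at this
    exact this
  rw [le_div_iff₀ hm]
  calc |deriv (levelRadius ε lev) θ| * (4 / π * c - 2 * δ₁) ≤ |deriv (levelRadius ε lev) θ| * a :=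
        mul_le_mul_of_nonneg_left ha' (abs_nonneg _)
    _ = |u| * |b| := hkey
    _ ≤ (π / 2) * (2 * (2 + δ₁)) := mul_le_mul hu2 hb' (abs_nonneg _) (by positivity)
    _ = π * (2 + δ₁) := by ring

/-- **The polar radius is Lipschitz in the angle**: `|u(θ) - u(θ')| ≤ [π(2 + δ₁)/(4c/π - 2δ₁)]·|θ - θ'|`.
[cite: BenfattoGiulianiMastropietro2006, §2.4 Lemma 2.1 (1) p0009:L39–L50] -/
theorem abs_levelRadius_sub_le (hε : ContDiff ℝ 2 ε) (h0 : ∀ k, |ε k - sqDispersion k| ≤ δ₀)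
    (h1 : ∀ k v, |fderiv ℝ ε k v - fderiv ℝ sqDispersion k v| ≤ δ₁ * (|v 0| + |v 1|)) (hδ₁ : 0 ≤ δ₁)
    (hc : 2 * δ₁ < 4 / π * c) (hlev : lev ∈ Ioo (c ^ 2 + δ₀ - 4) (-2 - Real.sqrt 2 - δ₀)) (θ θ' : ℝ) :
    |levelRadius ε lev θ - levelRadius ε lev θ'| ≤ π * (2 + δ₁) / (4 / π * c - 2 * δ₁) * |θ - θ'| := by
  have hdiff : ∀ x ∈ (Set.univ : Set ℝ), DifferentiableAt ℝ (levelRadius ε lev) x := fun x _ =>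
    ((contDiff_levelRadius hε le_rfl h0 h1 hδ₁ hc hlev).differentiable (by simp)) x
  have h := Convex.norm_image_sub_le_of_norm_deriv_le hdiff
    (fun x _ => (Real.norm_eq_abs _).le.trans (abs_deriv_levelRadius_le hε h0 h1 hδ₁ hc hlev x))
    convex_univ (Set.mem_univ θ') (Set.mem_univ θ)
  rw [Real.norm_eq_abs, Real.norm_eq_abs] at h
  exact h

/-- **Chord estimate for the Fermi curve in `ℓ¹`**: for `P(θ) = u(θ)e⃗_r(θ)`,
`|P(θ)ᵢ - P(θ₀)ᵢ| ≤ |u(θ) - u(θ₀)| + u(θ₀)|θ - θ₀|` (`|cos θ - cos θ₀|, |sin θ - sin θ₀| ≤ |θ - θ₀|`).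
[folklore] -/
private theorem abs_polarCurve_sub_apply_le {u : ℝ → ℝ} {θ₀ : ℝ} (hu0 : 0 ≤ u θ₀) (θ : ℝ) (i : Fin 2) :
    |(u θ • dir θ - u θ₀ • dir θ₀) i| ≤ |u θ - u θ₀| + u θ₀ * |θ - θ₀| := by
  have hdec : (u θ • dir θ - u θ₀ • dir θ₀) i = (u θ - u θ₀) * dir θ i + u θ₀ * (dir θ i - dir θ₀ i) := by
    simp only [Pi.sub_apply, Pi.smul_apply, smul_eq_mul]; ring
  rw [hdec]
  have htrig : |dir θ i - dir θ₀ i| ≤ |θ - θ₀| := by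
    fin_cases i
    · exact Real.abs_cos_sub_cos_le θ θ₀
    · exact Real.abs_sin_sub_sin_le θ θ₀
  calc |(u θ - u θ₀) * dir θ i + u θ₀ * (dir θ i - dir θ₀ i)|
      ≤ |(u θ - u θ₀) * dir θ i| + |u θ₀ * (dir θ i - dir θ₀ i)| := abs_add_le _ _
    _ = |u θ - u θ₀| * |dir θ i| + u θ₀ * |dir θ i - dir θ₀ i| := by
        rw [abs_mul, abs_mul, abs_of_nonneg hu0]
    _ ≤ |u θ - u θ₀| * 1 + u θ₀ * |θ - θ₀| := by
        gcongr
        exact abs_dir_le_one θ i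
    _ = _ := by rw [mul_one]

end Curve

/-! ### §5 Discrete mean-value estimates on the Matsubara lattice -/

section Matsubara

variable {β U : ℝ} {C : ℕ → ℝ} {hβ : ℤ} {E : ℤ → ℝ × (Fin 2 → ℝ) → ℂ}

/-- **Telescoping on `ℤ`**: if consecutive values differ by at most `M` then `‖φ(j) - φ(0)‖ ≤ |j| M`. [folklore] -/
private theorem norm_sub_le_abs_mul_of_succ {X : Type*} [SeminormedAddCommGroup X] (φ : ℤ → X) {M : ℝ}
    (hM : ∀ i : ℤ, ‖φ (i + 1) - φ i‖ ≤ M) (j : ℤ) : ‖φ j - φ 0‖ ≤ |(j : ℝ)| * M := by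
  have up : ∀ ψ : ℤ → X, (∀ i : ℤ, ‖ψ (i + 1) - ψ i‖ ≤ M) → ∀ n : ℕ, ‖ψ n - ψ 0‖ ≤ n * M := by
    intro ψ hψ n
    induction n with
    | zero => simp
    | succ n ih =>
      calc ‖ψ ((n + 1 : ℕ) : ℤ) - ψ 0‖ = ‖(ψ ((n : ℤ) + 1) - ψ n) + (ψ n - ψ 0)‖ := by
            push_cast; congr 1; abel
        _ ≤ ‖ψ ((n : ℤ) + 1) - ψ n‖ + ‖ψ n - ψ 0‖ := norm_add_le _ _
        _ ≤ M + n * M := add_le_add (hψ n) ih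
        _ = ((n + 1 : ℕ) : ℝ) * M := by push_cast; ring
  obtain ⟨n, rfl | rfl⟩ := Int.eq_nat_or_neg j
  · have h := up φ hM n
    have e : |((n : ℤ) : ℝ)| = n := by push_cast; exact Nat.abs_cast n
    rw [e]; exact h
  · have hψ : ∀ i : ℤ, ‖φ (-(i + 1)) - φ (-i)‖ ≤ M := fun i => by
      have h := hM (-(i + 1))
      rw [show -(i + 1) + 1 = -i by ring] at h
      rw [norm_sub_rev]; exact h
    have h := up (fun i => φ (-i)) hψ n
    have e : |((-(n : ℤ) : ℤ) : ℝ)| = n := by push_cast; rw [abs_neg]; exact Nat.abs_cast n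
    rw [e]
    simpa using h

/-- Consecutive fermionic Matsubara frequencies differ by `2π/β`. [folklore] -/
private theorem fermiMatsubara_succ (β : ℝ) (i : ℤ) : fermiMatsubara β (i + 1) = fermiMatsubara β i + 2 * π / β := by
  simp only [fermiMatsubara]; push_cast; ring

/-- `k₀(0) = π/β`. [folklore] -/
private theorem fermiMatsubara_zero' (β : ℝ) : fermiMatsubara β 0 = π / β := by
  simp [fermiMatsubara]

/-- `|j|·(2π/β) = |k₀(j) - π/β|` for `β > 0`. [folklore] -/
private theorem abs_mul_two_pi_div_eq {β : ℝ} (hβ : 0 < β) (j : ℤ) :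
    |(j : ℝ)| * (2 * π / β) = |fermiMatsubara β j - π / β| := by
  have e : fermiMatsubara β j - π / β = (j : ℝ) * (2 * π / β) := by
    simp only [fermiMatsubara]; field_simp; ring
  rw [e, abs_mul, abs_of_pos (by positivity : (0 : ℝ) < 2 * π / β)]

/-- `|k₀(j) - π/β| ≤ 2|k₀(j)|` (`π/β ≤ |k₀(j)|`). [folklore] -/
private theorem abs_fermiMatsubara_sub_le {β : ℝ} (hβ : 0 < β) (j : ℤ) :
    |fermiMatsubara β j - π / β| ≤ 2 * |fermiMatsubara β j| := by
  have h := pi_div_le_abs_fermiMatsubara hβ j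
  calc |fermiMatsubara β j - π / β| ≤ |fermiMatsubara β j| + |π / β| := abs_sub _ _
    _ = |fermiMatsubara β j| + π / β := by rw [abs_of_pos (by positivity : (0 : ℝ) < π / β)]
    _ ≤ _ := by linarith

/-- A step of the Matsubara lattice in terms of the first discrete time derivative (2.36aa):
`f(k₀ + 2π/β, q⃗) - f(k₀, q⃗) = (2π/β)·∂_{k₀}f(k₀, q⃗)`. [cite: BenfattoGiulianiMastropietro2006, §2.3 (2.36aa) p0008:L55] -/
theorem sub_eq_smul_bgmTimeDiffIter_one {β : ℝ} (hβ : 0 < β) (f : ℝ × (Fin 2 → ℝ) → ℂ) (k₀ : ℝ)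
    (q : Fin 2 → ℝ) :
    f (k₀ + 2 * π / β, q) - f (k₀, q) = ((2 * π / β : ℝ)) • bgmTimeDiffIter β 1 f (k₀, q) := by
  rw [bgmTimeDiffIter_one_apply, smul_smul]
  have : 2 * π / β * (β / (2 * π)) = 1 := by field_simp
  rw [this, one_smul]

/-- **Discrete mean value along the Matsubara lattice, values**: under (2.36), for `h_β - 1 ≤ h' ≤ 0`,
`‖E_{h'}(k₀(j), q⃗) - E_{h'}(π/β, q⃗)‖ ≤ |k₀(j) - π/β|·2C₁U²` (`|∂_{k₀}E_{h'}| ≤ 2C₁U²` on `D_β`).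
[cite: BenfattoGiulianiMastropietro2006, §2.4 (2.42)–(2.44) p0009:L101–p0010:L4] -/
theorem norm_E_sub_E_pi_div_le (hI : BGMInitial E) (hS : BGMSmoothness β U C hβ E) (hβpos : 0 < β)
    {h' : ℤ} (hh₁ : hβ - 1 ≤ h') (hh₀ : h' ≤ 0) (j : ℤ) (q : Fin 2 → ℝ) :
    ‖E h' (fermiMatsubara β j, q) - E h' (π / β, q)‖ ≤ |fermiMatsubara β j - π / β| * (2 * |C 1| * U ^ 2) := by
  have hM : ∀ i : ℤ, ‖E h' (fermiMatsubara β (i + 1), q) - E h' (fermiMatsubara β i, q)‖ ≤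
      2 * π / β * (2 * |C 1| * U ^ 2) := by
    intro i
    rw [fermiMatsubara_succ, sub_eq_smul_bgmTimeDiffIter_one hβpos, norm_smul, Real.norm_eq_abs,
      abs_of_pos (by positivity : (0 : ℝ) < 2 * π / β)]
    exact mul_le_mul_of_nonneg_left (norm_bgmTimeDiffIter_one_le hI hS hh₁ hh₀ ⟨i, rfl⟩ q) (by positivity)
  have h := norm_sub_le_abs_mul_of_succ (fun i => E h' (fermiMatsubara β i, q)) hM j
  simp only [fermiMatsubara_zero'] at h
  rw [← mul_assoc, abs_mul_two_pi_div_eq hβpos] at h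
  exact h

/-- `‖L v‖ ≤ B(|v₁| + |v₂|)` for a linear map on `ℝ²` with `‖L e₁‖, ‖L e₂‖ ≤ B`. [folklore] -/
private theorem norm_clm_apply_le_of_basis {F : Type*} [NormedAddCommGroup F] [NormedSpace ℝ F]
    (L : (Fin 2 → ℝ) →L[ℝ] F) {B : ℝ} (h0 : ‖L (Pi.single 0 1)‖ ≤ B) (h1 : ‖L (Pi.single 1 1)‖ ≤ B)
    (v : Fin 2 → ℝ) : ‖L v‖ ≤ B * (|v 0| + |v 1|) := by
  have hv : v = v 0 • (Pi.single 0 1 : Fin 2 → ℝ) + v 1 • (Pi.single 1 1 : Fin 2 → ℝ) := by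
    ext i; fin_cases i <;> simp
  calc ‖L v‖ = ‖v 0 • L (Pi.single 0 1) + v 1 • L (Pi.single 1 1)‖ := by
        conv_lhs => rw [hv]
        rw [map_add, map_smul, map_smul]
    _ ≤ ‖v 0 • L (Pi.single 0 1)‖ + ‖v 1 • L (Pi.single 1 1)‖ := norm_add_le _ _
    _ = |v 0| * ‖L (Pi.single 0 1)‖ + |v 1| * ‖L (Pi.single 1 1)‖ := by
        rw [norm_smul, norm_smul, Real.norm_eq_abs, Real.norm_eq_abs]
    _ ≤ |v 0| * B + |v 1| * B := by gcongr
    _ = B * (|v 0| + |v 1|) := by ring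

/-- **Discrete mean value along the Matsubara lattice, gradients**: under (2.36), for `h_β - 1 ≤ h' ≤ 0`,
`‖∇E_{h'}(k₀(j), ·)(q⃗)·v⃗ - ∇E_{h'}(π/β, ·)(q⃗)·v⃗‖ ≤ |k₀(j) - π/β|·C₂U²h'²(|v₁| + |v₂|)` (the mixed
derivatives `|∂_{k⃗}∂_{k₀}E_{h'}| ≤ C₂U²h'²`). [cite: BenfattoGiulianiMastropietro2006, §2.4 (2.42) p0009:L101] -/
theorem norm_fderiv_E_sub_fderiv_E_pi_div_le (hI : BGMInitial E) (hS : BGMSmoothness β U C hβ E)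
    (hβpos : 0 < β) {h' : ℤ} (hh₁ : hβ - 1 ≤ h') (hh₀ : h' ≤ 0) (j : ℤ) (q v : Fin 2 → ℝ) :
    ‖fderiv ℝ (fun q => E h' (fermiMatsubara β j, q)) q v - fderiv ℝ (fun q => E h' (π / β, q)) q v‖ ≤
      |fermiMatsubara β j - π / β| * (|C 2| * U ^ 2 * (h' : ℝ) ^ 2 * (|v 0| + |v 1|)) := by
  have hS1 := hS.1
  have hdE : ∀ k₀ : ℝ, Differentiable ℝ (fun q => E h' (k₀, q)) := fun k₀ =>
    (hS1 h' k₀ 1).differentiable (by simp)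
  have hM : ∀ i : ℤ, ‖fderiv ℝ (fun q => E h' (fermiMatsubara β (i + 1), q)) q v -
      fderiv ℝ (fun q => E h' (fermiMatsubara β i, q)) q v‖ ≤
      2 * π / β * (|C 2| * U ^ 2 * (h' : ℝ) ^ 2 * (|v 0| + |v 1|)) := by
    intro i
    have hk₀ : fermiMatsubara β i ∈ matsubaraSet β := ⟨i, rfl⟩
    obtain ⟨hTd, -⟩ := norm_fderiv_bgmTimeDiffIter_one_le hI hS hh₁ hh₀ hk₀ q 0
    have hb : ∀ l : Fin 2, ‖fderiv ℝ (fun k' => bgmTimeDiffIter β 1 (E h') (fermiMatsubara β i, k')) q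
        (Pi.single l 1)‖ ≤ |C 2| * U ^ 2 * (h' : ℝ) ^ 2 := fun l =>
      (norm_fderiv_bgmTimeDiffIter_one_le hI hS hh₁ hh₀ hk₀ q l).2
    -- the step as a scalar multiple of the time difference, as functions of `q`
    have hfun : (fun q => E h' (fermiMatsubara β (i + 1), q)) = fun q =>
        E h' (fermiMatsubara β i, q) + ((2 * π / β : ℝ)) • bgmTimeDiffIter β 1 (E h') (fermiMatsubara β i, q) := by
      funext q'
      rw [fermiMatsubara_succ, ← sub_eq_smul_bgmTimeDiffIter_one hβpos]
      abel
    have hderiv : HasFDerivAt (fun q => E h' (fermiMatsubara β i, q) +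
        ((2 * π / β : ℝ)) • bgmTimeDiffIter β 1 (E h') (fermiMatsubara β i, q))
        (fderiv ℝ (fun q => E h' (fermiMatsubara β i, q)) q +
          ((2 * π / β : ℝ)) • fderiv ℝ (fun k' => bgmTimeDiffIter β 1 (E h') (fermiMatsubara β i, k')) q) q :=
      ((hdE _) q).hasFDerivAt.add (hTd.hasFDerivAt.fun_const_smul _)
    rw [hfun, hderiv.fderiv]
    simp only [add_apply, FunLike.coe_smul, Pi.smul_apply,
      add_sub_cancel_left, norm_smul, Real.norm_eq_abs, abs_of_pos (by positivity : (0 : ℝ) < 2 * π / β)]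
    exact mul_le_mul_of_nonneg_left (norm_clm_apply_le_of_basis _ (hb 0) (hb 1) v) (by positivity)
  have h := norm_sub_le_abs_mul_of_succ (fun i => fderiv ℝ (fun q => E h' (fermiMatsubara β i, q)) q v) hM j
  simp only [fermiMatsubara_zero'] at h
  rw [← mul_assoc, abs_mul_two_pi_div_eq hβpos] at h
  exact h

/-- **`E_h(π/β, ·) - ε_h = (π/β)·∂_{k₀}E_h(-π/β, ·)`** (`= i·Im E_h(π/β, ·)` by (2.36a), (2.44)).
[cite: BenfattoGiulianiMastropietro2006, §2.4 (2.36c), (2.44) p0008:L112, p0009:L150] -/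
theorem E_pi_div_sub_bgmEffDisp (hSy : BGMSymmetry E) {β : ℝ} (hβ : 0 < β) (h' : ℤ) (q : Fin 2 → ℝ) :
    E h' (π / β, q) - ((bgmEffDisp β E h' q : ℝ) : ℂ) =
      ((π / β : ℝ)) • bgmTimeDiffIter β 1 (E h') (-(π / β), q) := by
  rw [bgmTimeDiffIter_one_neg_pi_div hSy β h' q, bgmEffDisp_eq_re hSy β h' q, Complex.real_smul]
  have h1 : E h' (π / β, q) - (((E h' (π / β, q)).re : ℝ) : ℂ) = Complex.I * (((E h' (π / β, q)).im : ℝ) : ℂ) := by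
    apply Complex.ext <;> simp
  rw [h1]
  have hβC : (β : ℂ) ≠ 0 := by exact_mod_cast hβ.ne'
  have hπC : (π : ℂ) ≠ 0 := by exact_mod_cast Real.pi_pos.ne'
  push_cast
  field_simp

end Matsubara

/-! ### §6 The support of `F_{h,ω}(k₀, ·)` in the moving frame: the box (2.46) -/

section Support

variable {μ e₀ β U c₀ : ℝ} {C : ℕ → ℝ} {hβ : ℤ} {E : ℤ → ℝ × (Fin 2 → ℝ) → ℂ} {h : ℤ}

/-- `|U||h| ≤ c₀` for `h_β ≤ h ≤ 0` once `|U||h_β| ≤ c₀`. [folklore] -/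
private theorem abs_U_mul_abs_le (hh₁ : hβ ≤ h) (hh₀ : h ≤ 0) (hUh : |U| * |(hβ : ℝ)| ≤ c₀) :
    |U| * |(h : ℝ)| ≤ c₀ := by
  have : |(h : ℝ)| ≤ |(hβ : ℝ)| := by
    rw [abs_of_nonpos (by exact_mod_cast hh₀), abs_of_nonpos (by exact_mod_cast (hh₁.trans hh₀))]
    exact_mod_cast neg_le_neg hh₁
  exact (mul_le_mul_of_nonneg_left this (abs_nonneg U)).trans hUh

/-- In the disc of radius `r` each coordinate is `< r` in absolute value. [folklore] -/
private theorem abs_apply_lt_of_sq_add_sq_lt' {r : ℝ} (hr : 0 ≤ r) {q : Fin 2 → ℝ} (hq : q 0 ^ 2 + q 1 ^ 2 < r ^ 2)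
    (i : Fin 2) : |q i| < r := by
  have h0 : q 0 ^ 2 < r ^ 2 := by nlinarith [sq_nonneg (q 1)]
  have h1 : q 1 ^ 2 < r ^ 2 := by nlinarith [sq_nonneg (q 0)]
  fin_cases i
  · exact abs_lt_of_sq_lt_sq h0 hr
  · exact abs_lt_of_sq_lt_sq h1 hr

/-- `γ^h ≤ γ^{h/2}`: `4^h ≤ 2^h` for `h ≤ 0`. [folklore] -/
private theorem four_zpow_le_two_zpow (hh₀ : h ≤ 0) : (4 : ℝ) ^ h ≤ (2 : ℝ) ^ h := by
  have h2 : (2 : ℝ) ^ h ≤ 1 := zpow_le_one_of_nonpos₀ (by norm_num) hh₀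
  have h2pos : (0 : ℝ) < (2 : ℝ) ^ h := zpow_pos (by norm_num) _
  calc (4 : ℝ) ^ h = (2 : ℝ) ^ h * (2 : ℝ) ^ h := by
        rw [show (4 : ℝ) = 2 * 2 by norm_num, mul_zpow]
    _ ≤ (2 : ℝ) ^ h * 1 := mul_le_mul_of_nonneg_left h2 h2pos.le
    _ = (2 : ℝ) ^ h := mul_one _

/-- `γ^h = (γ^{h/2})²`: `4^h = (2^h)²`. [folklore] -/
private theorem four_zpow_eq_two_zpow_sq (h : ℤ) : (4 : ℝ) ^ h = ((2 : ℝ) ^ h) ^ 2 := by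
  rw [show (4 : ℝ) = 2 * 2 by norm_num, mul_zpow, sq]

/-- The anisotropic sector width at scale `h ≤ 0`: `w_n = π/2^n = πγ^{h/2} = π·2^h` (`n = -h`).
[cite: BenfattoGiulianiMastropietro2006, §2.5 (2.45) p0010:L27] -/
theorem sectorWidth_bgmScaleIdx (hh₀ : h ≤ 0) : sectorWidth (bgmScaleIdx h) = π * (2 : ℝ) ^ h := by
  have hn : ((bgmScaleIdx h : ℕ) : ℤ) = -h := by simp [bgmScaleIdx, Int.toNat_of_nonneg (neg_nonneg.2 hh₀)]
  rw [sectorWidth, ← zpow_natCast, hn, zpow_neg, div_eq_mul_inv, inv_inv]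

/-- The isotropic sector width at scale `h ≤ 0`: `w_{2n} = π/4^n = πγ^h = π·4^h`.
[cite: BenfattoGiulianiMastropietro2006, §2.5 (2.57) p0011:L118] -/
theorem sectorWidth_two_mul_bgmScaleIdx (hh₀ : h ≤ 0) : sectorWidth (2 * bgmScaleIdx h) = π * (4 : ℝ) ^ h := by
  have hn : ((bgmScaleIdx h : ℕ) : ℤ) = -h := by simp [bgmScaleIdx, Int.toNat_of_nonneg (neg_nonneg.2 hh₀)]
  rw [sectorWidth, pow_mul, show (2 : ℝ) ^ 2 = 4 by norm_num, ← zpow_natCast, hn, zpow_neg, div_eq_mul_inv,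
    inv_inv]

/-- **The scale-`h` effective dispersion as a `C²`-small perturbation of `ε₀` under the coupled smallness**
(`|U| ≤ c₀`, `|U||h| ≤ c₀`): `|ε_h - ε₀| ≤ 2C₀c₀`, `|∇(ε_h - ε₀)·v⃗| ≤ 2C₁c₀²|v⃗|₁`,
`|D²(ε_h - ε₀)(v⃗,w⃗)| ≤ C₂c₀²|v⃗|₁|w⃗|₁` ((2.41a)). [cite: BenfattoGiulianiMastropietro2006, §2.4 (2.41a) p0009:L77–L84] -/
theorem bgmEffDisp_perturbation_small (hI : BGMInitial E) (hS : BGMSmoothness β U C hβ E) (hh₁ : hβ ≤ h)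
    (hh₀ : h ≤ 0) (hU : |U| ≤ c₀) (hUh : |U| * |(hβ : ℝ)| ≤ c₀) :
    ContDiff ℝ 2 (bgmEffDisp β E h) ∧
    (∀ k, |bgmEffDisp β E h k - sqDispersion k| ≤ 2 * |C 0| * c₀) ∧
    (∀ k v, |fderiv ℝ (bgmEffDisp β E h) k v - fderiv ℝ sqDispersion k v| ≤
        2 * |C 1| * c₀ ^ 2 * (|v 0| + |v 1|)) ∧
    (∀ k v w, |fderiv ℝ (fderiv ℝ (bgmEffDisp β E h)) k v w - fderiv ℝ (fderiv ℝ sqDispersion) k v w| ≤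
        |C 2| * c₀ ^ 2 * (|v 0| + |v 1|) * (|w 0| + |w 1|)) := by
  obtain ⟨hε2, h0, h1, h2⟩ := bgmEffDisp_perturbation hI hS hh₁ hh₀
  have hUsq : U ^ 2 ≤ c₀ ^ 2 := by rw [← sq_abs U]; exact pow_le_pow_left₀ (abs_nonneg U) hU 2
  have hUh' : (U * h) ^ 2 ≤ c₀ ^ 2 := by
    have := abs_U_mul_abs_le hh₁ hh₀ hUh
    rw [← abs_mul] at this
    rw [← sq_abs (U * h)]
    exact pow_le_pow_left₀ (abs_nonneg _) this 2
  refine ⟨hε2, fun k => (h0 k).trans (by gcongr), fun k v => (h1 k v).trans (by gcongr), fun k v w =>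
    (h2 k v w).trans ?_⟩
  have : 0 ≤ (|v 0| + |v 1|) * (|w 0| + |w 1|) := by positivity
  calc |C 2| * (U * h) ^ 2 * (|v 0| + |v 1|) * (|w 0| + |w 1|)
      = |C 2| * (U * h) ^ 2 * ((|v 0| + |v 1|) * (|w 0| + |w 1|)) := by ring
    _ ≤ |C 2| * c₀ ^ 2 * ((|v 0| + |v 1|) * (|w 0| + |w 1|)) := by gcongr
    _ = _ := by ring

/-- **The scale-`h` Fermi curve `p⃗_F^{(h)}(θ) = u_h(θ, 0)e⃗_r(θ)` under the coupled smallness**: with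
`c' = √((μ + 4 - e₀)/2)` and `u = levelRadius ε_h μ`: `u(θ)` is the root on every ray, `c' ≤ u(θ) < π/4`,
`u` is differentiable, the radial slope at the curve is `≥ 2c'/π` ((2.41)), and `u` is Lipschitz with constant
`π(2 + 2C₁c₀²)/(2c'/π)`. [cite: BenfattoGiulianiMastropietro2006, §2.4 Lemma 2.1 (1)–(2) p0009:L39–L60] -/
theorem fermiCurve_data (hI : BGMInitial E) (hS : BGMSmoothness β U C hβ E) (hh₁ : hβ ≤ h) (hh₀ : h ≤ 0)
    (hU : |U| ≤ c₀) (hUh : |U| * |(hβ : ℝ)| ≤ c₀) (he : 0 < e₀)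
    (hgap : μ + e₀ + 2 * |C 0| * c₀ < -2 - Real.sqrt 2) (hgap' : 2 * |C 0| * c₀ ≤ (μ + 4 - e₀) / 2) (he4 : e₀ < μ + 4)
    (hδ₁ : 2 * (2 * |C 1| * c₀ ^ 2) ≤ 2 / π * Real.sqrt ((μ + 4 - e₀) / 2)) (θ : ℝ) :
    IsLevelRadius (bgmEffDisp β E h) μ θ (levelRadius (bgmEffDisp β E h) μ θ) ∧
    Real.sqrt ((μ + 4 - e₀) / 2) ≤ levelRadius (bgmEffDisp β E h) μ θ ∧
    levelRadius (bgmEffDisp β E h) μ θ < π / 4 ∧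
    DifferentiableAt ℝ (levelRadius (bgmEffDisp β E h) μ) θ ∧
    2 / π * Real.sqrt ((μ + 4 - e₀) / 2) ≤
      fderiv ℝ (bgmEffDisp β E h) (levelRadius (bgmEffDisp β E h) μ θ • dir θ) (dir θ) ∧
    (∀ θ₁ θ₂ : ℝ, |levelRadius (bgmEffDisp β E h) μ θ₁ - levelRadius (bgmEffDisp β E h) μ θ₂| ≤
      π * (2 + 2 * |C 1| * c₀ ^ 2) / (2 / π * Real.sqrt ((μ + 4 - e₀) / 2)) * |θ₁ - θ₂|) := by
  set c' := Real.sqrt ((μ + 4 - e₀) / 2) with hc'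
  have hπ := Real.pi_pos
  have hc'0 : 0 < c' := Real.sqrt_pos.2 (by linarith)
  have hc'sq : c' ^ 2 = (μ + 4 - e₀) / 2 := Real.sq_sqrt (by linarith)
  have hc₀ : 0 ≤ c₀ := (abs_nonneg U).trans hU
  obtain ⟨hε2, h0, h1, -⟩ := bgmEffDisp_perturbation_small hI hS hh₁ hh₀ hU hUh
  have hδ₁0 : 0 ≤ 2 * |C 1| * c₀ ^ 2 := by positivity
  have h24 : 2 / π * c' < 4 / π * c' := by
    rw [div_mul_eq_mul_div, div_mul_eq_mul_div]; exact div_lt_div_of_pos_right (by linarith) hπ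
  have hcδ : 2 * (2 * |C 1| * c₀ ^ 2) < 4 / π * c' := lt_of_le_of_lt hδ₁ h24
  have hlev : μ ∈ Ioo (c' ^ 2 + 2 * |C 0| * c₀ - 4) (-2 - Real.sqrt 2 - 2 * |C 0| * c₀) := by
    rw [hc'sq]; constructor <;> linarith
  obtain ⟨hroot, hcu, huK, hK⟩ := levelRadius_bounds hε2 h0 hδ₁0 hcδ hlev θ
  have hm : 2 / π * c' ≤ 4 / π * c' - 2 * (2 * |C 1| * c₀ ^ 2) := by
    have : 4 / π * c' = 2 / π * c' + 2 / π * c' := by ring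
    linarith
  refine ⟨hroot, hcu, lt_of_le_of_lt huK hK,
    ((contDiff_levelRadius hε2 le_rfl h0 h1 hδ₁0 hcδ hlev).differentiable (by simp)) θ, ?_, ?_⟩
  · have hslope := fderiv_ray_dir_ge' h1 hδ₁0 hroot.1.1 hroot.1.2 θ
    have : 4 / π * c' ≤ 4 / π * levelRadius (bgmEffDisp β E h) μ θ :=
      mul_le_mul_of_nonneg_left hcu (by positivity)
    linarith
  · intro θ₁ θ₂
    have hd := abs_levelRadius_sub_le hε2 h0 h1 hδ₁0 hcδ hlev θ₁ θ₂
    have hmpos : 0 < 2 / π * c' := by positivity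
    exact hd.trans (mul_le_mul_of_nonneg_right (div_le_div_of_nonneg_left (by positivity) hmpos hm)
      (abs_nonneg _))

/-- **Polar data of a point of the support of `F_{h,ω}(k₀(j), ·)`**, every scale: if `q⃗` lies in the
disc `|q⃗| < 3π/4` and `F_{h,ω}(k₀(j), q⃗) ≠ 0` (angular index `m`, sector `ω`), then `q⃗ = ρe⃗_r(θ)` with
`ρ = |q⃗| ∈ (0, π/4)`, `θ = θ(q⃗) ∈ (-π, π]`, the frequency is in the support `|k₀(j)| < 8e₀γ^h`, the
sharp level window `|Re E_h(k₀(j), q⃗) - μ| < e₀γ^h` holds, and the angle is within `¾w_m` of the centre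
`(ω + ½)w_m` modulo `2π` ((2.42a), (2.45)). [cite: BenfattoGiulianiMastropietro2006, §2.4 (2.42a) p0010:L9–L16, §2.5 (2.45)–(2.46) p0010:L27–L55] -/
theorem support_polar (hI : BGMInitial E) (hSy : BGMSymmetry E) (hS : BGMSmoothness β U C hβ E)
    (he : 0 < e₀) (hβpos : 0 < β) (hh₁ : hβ ≤ h) (hh₀ : h ≤ 0) (hU : |U| ≤ c₀) (hUh : |U| * |(hβ : ℝ)| ≤ c₀)
    (hμ₁ : -4 < μ) (hK₀ : |C 0| * c₀ ≤ 3 / 16 * e₀) (hK₁ : 2 * |C 1| * c₀ ^ 2 ≤ 1 / 2)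
    (hK₂' : 2 * (4 * |C 2| * c₀ ^ 2) * (2 * |C 0| * c₀ + 2 * e₀) ≤ 1)
    (hgap : μ + e₀ + 2 * |C 0| * c₀ < -2 - Real.sqrt 2) (hgap' : 2 * |C 0| * c₀ ≤ (μ + 4 - e₀) / 2)
    (he4 : e₀ < μ + 4)
    {m : ℕ} {ω j : ℤ} {q : Fin 2 → ℝ} (hq : q 0 ^ 2 + q 1 ^ 2 < (3 * π / 4) ^ 2)
    (hF : bgmSectorFn e₀ μ E h m ω (fermiMatsubara β j, q) ≠ 0) :
    0 < ‖momToComplex q‖ ∧ ‖momToComplex q‖ < π / 4 ∧ q = ‖momToComplex q‖ • dir (polarAngle q) ∧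
    polarAngle q ∈ Ioc (-π) π ∧
    |fermiMatsubara β j| < 8 * e₀ * (4 : ℝ) ^ h ∧
    |(E h (fermiMatsubara β j, q)).re - μ| < e₀ * (4 : ℝ) ^ h ∧
    ∃ kk : ℤ, |polarAngle q - ((ω : ℝ) + 1 / 2) * sectorWidth m - 2 * π * kk| < 3 * sectorWidth m / 4 := by
  have hπ := Real.pi_pos
  have hf : bgmShell e₀ μ E h (fermiMatsubara β j, q) ≠ 0 := left_ne_zero_of_mul hF
  have hζ : sectorWeightCirc m ω (polarAngle q) ≠ 0 := right_ne_zero_of_mul hF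
  have hρsq : ‖momToComplex q‖ ^ 2 = q 0 ^ 2 + q 1 ^ 2 := norm_momToComplex_sq q
  have hball : q 0 ^ 2 + q 1 ^ 2 < (π / 4) ^ 2 :=
    sq_add_sq_lt_of_bgmShell_ne_zero hI hS he hh₁ hh₀ hU hUh hμ₁ hK₀ hgap (fun i =>
      (abs_apply_lt_of_sq_add_sq_lt' (by positivity) hq i).trans (by linarith)) hf
  have hann := lt_sq_add_sq_of_bgmShell_ne_zero hI hS he hh₁ hh₀ hU hUh hK₀ hf
  have hc₀ : 0 ≤ c₀ := (abs_nonneg U).trans hU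
  have hlow : 0 < q 0 ^ 2 + q 1 ^ 2 := by linarith
  have hρne : ‖momToComplex q‖ ≠ 0 := fun h0 => by
    rw [h0] at hρsq; simp at hρsq; linarith
  have hρpos : 0 < ‖momToComplex q‖ := lt_of_le_of_ne (norm_nonneg _) (Ne.symm hρne)
  have hρlt : ‖momToComplex q‖ < π / 4 :=
    lt_of_pow_lt_pow_left₀ 2 (by positivity) (by rw [hρsq]; exact hball)
  have hk₀ : fermiMatsubara β j ∈ matsubaraSet β := ⟨j, rfl⟩
  have hη := norm_E_sub_E_le_threshold hS hh₁ hh₀ hUh hK₀ hk₀ q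
  have hang : ∃ kk : ℤ, |polarAngle q - ((ω : ℝ) + 1 / 2) * sectorWidth m - 2 * π * kk| < 3 * sectorWidth m / 4 := by
    by_contra hnone
    push Not at hnone
    exact hζ (sectorWeightCirc_eq_zero hnone)
  exact ⟨hρpos, hρlt, polar_repr q, ⟨Complex.neg_pi_lt_arg _, Complex.arg_le_pi _⟩,
    abs_k0_lt_of_bgmShell_ne_zero hI hSy hS he hβpos hh₁ hh₀ hU hUh hK₀ hK₁ hK₂' hf,
    abs_re_sub_lt_of_bgmShell_ne_zero he hη hf, hang⟩

/-- **`|ε_h(q⃗) - μ| ≤ (1 + 32C₁c₀²)e₀γ^h` on the support, every scale**: the sharp window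
`|Re E_h(k₀, q⃗) - μ| < e₀γ^h` at the frequency `k₀ = k₀(j)` of the support (`|k₀| < 8e₀γ^h`) and the
discrete mean value `|E_h(k₀, q⃗) - E_h(π/β, q⃗)| ≤ 2|k₀|·2C₁c₀²` (`ε_h = Re E_h(π/β, ·)`) — the level half
of (2.42a) `K⁻¹e₀γ^h ≤ |k₀| + |ε_h(k⃗) - μ| ≤ Ke₀γ^h`. [cite: BenfattoGiulianiMastropietro2006, §2.4 (2.42a) p0010:L9–L16] -/
theorem abs_bgmEffDisp_sub_le_of_window (hI : BGMInitial E) (hSy : BGMSymmetry E) (hS : BGMSmoothness β U C hβ E)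
    (hβpos : 0 < β) (hh₁ : hβ ≤ h) (hh₀ : h ≤ 0) (hU : |U| ≤ c₀) (he : 0 ≤ e₀)
    {j : ℤ} {q : Fin 2 → ℝ} (hj : |fermiMatsubara β j| ≤ 8 * e₀ * (4 : ℝ) ^ h)
    (hwin : |(E h (fermiMatsubara β j, q)).re - μ| ≤ e₀ * (4 : ℝ) ^ h) :
    |(E h (fermiMatsubara β j, q)).re - bgmEffDisp β E h q| ≤ 32 * |C 1| * c₀ ^ 2 * (e₀ * (4 : ℝ) ^ h) ∧
    |bgmEffDisp β E h q - μ| ≤ (1 + 32 * |C 1| * c₀ ^ 2) * (e₀ * (4 : ℝ) ^ h) := by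
  have hUsq : U ^ 2 ≤ c₀ ^ 2 := by rw [← sq_abs U]; exact pow_le_pow_left₀ (abs_nonneg U) hU 2
  have hΔ : |(E h (fermiMatsubara β j, q)).re - bgmEffDisp β E h q| ≤ 32 * |C 1| * c₀ ^ 2 * (e₀ * (4 : ℝ) ^ h) := by
    rw [bgmEffDisp_eq_re hSy β h q, ← Complex.sub_re]
    refine (Complex.abs_re_le_norm _).trans ?_
    have h1 := norm_E_sub_E_pi_div_le hI hS hβpos (h' := h) (by omega) hh₀ j q
    have h2 := abs_fermiMatsubara_sub_le hβpos j
    calc _ ≤ |fermiMatsubara β j - π / β| * (2 * |C 1| * U ^ 2) := h1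
      _ ≤ (2 * (8 * e₀ * (4 : ℝ) ^ h)) * (2 * |C 1| * c₀ ^ 2) := by
          refine mul_le_mul (h2.trans (by linarith)) (by gcongr) (by positivity) (by positivity)
      _ = _ := by ring
  refine ⟨hΔ, ?_⟩
  have := abs_sub_le (bgmEffDisp β E h q) ((E h (fermiMatsubara β j, q)).re) μ
  rw [abs_sub_comm] at hΔ
  linarith

/-- **Radial localisation relative to THE scale-`h` Fermi curve**, every scale: a support point
`q⃗ = ρe⃗_r(θ)` of `f_h(k₀(j), ·)` (`0 < ρ < 3π/4`) has `|ρ - u_h(θ, 0)| ≤ (π/(2c'))(1 + 32C₁c₀²)e₀γ^h`,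
`u_h(·, 0) = levelRadius ε_h μ` — t1's localisation at the frequency-`k₀(j)` level curve
(`BGM2006Sec2ShellSupport.radial_localisation`) combined with the distance `≤ (Δ_j)/(2c'/π)` between that
curve and the curve of `ε_h` along the ray (radial separation), `Δ_j = sup|Re E_h(k₀(j),·) - ε_h| ≤ 32C₁c₀²e₀γ^h`.
[cite: BenfattoGiulianiMastropietro2006, §2.5 (2.46) p0010:L55–L67, proof of Lemma 2.2 p0011:L3–L6] -/
theorem abs_radius_sub_levelRadius_le (hI : BGMInitial E) (hSy : BGMSymmetry E) (hS : BGMSmoothness β U C hβ E)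
    (he : 0 < e₀) (hβpos : 0 < β) (hh₁ : hβ ≤ h) (hh₀ : h ≤ 0) (hU : |U| ≤ c₀) (hUh : |U| * |(hβ : ℝ)| ≤ c₀)
    (hμ₁ : -4 < μ) (hK₀ : |C 0| * c₀ ≤ 3 / 16 * e₀) (hK₁ : 2 * |C 1| * c₀ ^ 2 ≤ 1 / 2)
    (hK₂' : 2 * (4 * |C 2| * c₀ ^ 2) * (2 * |C 0| * c₀ + 2 * e₀) ≤ 1)
    (hgap : μ + e₀ + 2 * |C 0| * c₀ < -2 - Real.sqrt 2)
    (hgap' : 2 * |C 0| * c₀ ≤ (μ + 4 - e₀) / 2) (he4 : e₀ < μ + 4)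
    (hδ₁ : 2 * (2 * |C 1| * c₀ ^ 2) ≤ 2 / π * Real.sqrt ((μ + 4 - e₀) / 2))
    {j : ℤ} {ρ θ : ℝ} (hρ : ρ ∈ Ioo (0 : ℝ) (3 * π / 4))
    (hf : bgmShell e₀ μ E h (fermiMatsubara β j, ρ • dir θ) ≠ 0) :
    |ρ - levelRadius (bgmEffDisp β E h) μ θ| ≤
      π / (2 * Real.sqrt ((μ + 4 - e₀) / 2)) * ((1 + 32 * |C 1| * c₀ ^ 2) * (e₀ * (4 : ℝ) ^ h)) := by
  set c' := Real.sqrt ((μ + 4 - e₀) / 2) with hc'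
  have hπ := Real.pi_pos
  have hc'0 : 0 < c' := Real.sqrt_pos.2 (by linarith)
  have hc₀ : 0 ≤ c₀ := (abs_nonneg U).trans hU
  have h4 : (0 : ℝ) < (4 : ℝ) ^ h := zpow_pos (by norm_num) _
  -- the frequency-`j` level curve
  set εj : (Fin 2 → ℝ) → ℝ := fun q => (E h (fermiMatsubara β j, q)).re with hεj
  obtain ⟨hρ4, hρuj⟩ := radial_localisation hI hS he hh₁ hh₀ hU hUh hμ₁ hK₀ hgap hgap' he4 hδ₁ hρ hf
  obtain ⟨hrootj, hcuj, -, -⟩ := radial_window hI hS he hh₁ hh₀ hU hgap hgap' he4 hδ₁ j θ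
  -- the curve of `ε_h`
  obtain ⟨hε2, h0, h1, -⟩ := bgmEffDisp_perturbation_small hI hS hh₁ hh₀ hU hUh
  obtain ⟨hroot, hcu, -, -, -, -⟩ := fermiCurve_data hI hS hh₁ hh₀ hU hUh he hgap hgap' he4 hδ₁ θ
  set uj := levelRadius εj μ θ with huj
  set u := levelRadius (bgmEffDisp β E h) μ θ with hu
  have hδ₁0 : 0 ≤ 2 * |C 1| * c₀ ^ 2 := by positivity
  -- radial separation for `ε_h` between the two roots
  have hsep := mul_abs_sub_le_abs_eps_sub hε2 h1 hδ₁0 hc'0.le θ (s := uj) (t := u)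
    ⟨hcuj, hrootj.1.2⟩ ⟨hcu, hroot.1.2⟩
  have hm : 2 / π * c' ≤ 4 / π * c' - 2 * (2 * |C 1| * c₀ ^ 2) := by
    have : 4 / π * c' = 2 / π * c' + 2 / π * c' := by ring
    linarith
  have hmpos : 0 < 2 / π * c' := by positivity
  -- the level defect at `uj e⃗_r`: `ε_h(uj e⃗_r) - μ = ε_h(uj e⃗_r) - Re E_h(k₀(j), uj e⃗_r)`
  have hjk : |fermiMatsubara β j| ≤ 8 * e₀ * (4 : ℝ) ^ h := by
    have hf' : bgmShell e₀ μ E h (fermiMatsubara β j, ρ • dir θ) ≠ 0 := hf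
    exact (abs_k0_lt_of_bgmShell_ne_zero hI hSy hS he hβpos hh₁ hh₀ hU hUh hK₀ hK₁ hK₂' hf').le
  have hdef : |bgmEffDisp β E h (uj • dir θ) - bgmEffDisp β E h (u • dir θ)| ≤
      32 * |C 1| * c₀ ^ 2 * (e₀ * (4 : ℝ) ^ h) := by
    rw [hroot.2]
    have hwin : |(E h (fermiMatsubara β j, uj • dir θ)).re - μ| ≤ e₀ * (4 : ℝ) ^ h := by
      have : εj (uj • dir θ) = μ := hrootj.2
      simp only [hεj] at this
      rw [this, sub_self, abs_zero]; positivity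
    have hΔ := (abs_bgmEffDisp_sub_le_of_window hI hSy hS hβpos hh₁ hh₀ hU he.le hjk hwin).1
    have e1 : bgmEffDisp β E h (uj • dir θ) - μ =
        -((E h (fermiMatsubara β j, uj • dir θ)).re - bgmEffDisp β E h (uj • dir θ)) := by
      have : (E h (fermiMatsubara β j, uj • dir θ)).re = μ := hrootj.2
      linarith
    rw [e1, abs_neg]; exact hΔ
  have h2 : |uj - u| ≤ 32 * |C 1| * c₀ ^ 2 * (e₀ * (4 : ℝ) ^ h) / (2 / π * c') := by
    rw [le_div_iff₀ hmpos]
    calc |uj - u| * (2 / π * c') ≤ (4 / π * c' - 2 * (2 * |C 1| * c₀ ^ 2)) * |uj - u| := by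
          rw [mul_comm]; exact mul_le_mul_of_nonneg_right hm (abs_nonneg _)
      _ ≤ _ := hsep.trans hdef
  have h3 : |ρ - u| ≤ |ρ - uj| + |uj - u| := abs_sub_le ρ uj u
  have e2 : π / (2 * c') = 1 / (2 / π * c') := by field_simp
  rw [e2]
  calc |ρ - u| ≤ e₀ * (4 : ℝ) ^ h / (2 / π * c') + 32 * |C 1| * c₀ ^ 2 * (e₀ * (4 : ℝ) ^ h) / (2 / π * c') := by
        linarith
    _ = 1 / (2 / π * c') * ((1 + 32 * |C 1| * c₀ ^ 2) * (e₀ * (4 : ℝ) ^ h)) := by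
        field_simp

end Support

section Box

variable {μ e₀ β U c₀ : ℝ} {C : ℕ → ℝ} {hβ : ℤ} {E : ℤ → ℝ × (Fin 2 → ℝ) → ℂ} {h : ℤ}

/-- **The box (2.46) in the moving frame (2.47), every scale** — BGM: "Using (2.42a) and (2.45) it is easy
to realize that `|k'₁| ≤ Cγ^h` and `|k'₂| ≤ Cγ^{h/2}` for some constant `C`; see Lemma 7.3 of [BGM] for
details."  Precisely: under (2.36) with the coupled smallness, if `q⃗` lies in the disc `|q⃗| < 3π/4` and
`F_{h,ω}(k₀(j), q⃗) ≠ 0` (angular index `m`, sector `ω`, centre `θ₀ = θ_{m,ω}`), then with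
`p⃗_F = u_h(θ₀,0)e⃗_r(θ₀)`, `k⃗' = q⃗ - p⃗_F`, `S = |k'₁| + |k'₂|` (`ℓ¹` norm), `c' = √((μ+4-e₀)/2)`,
`W = (1 + 32C₁c₀²)e₀`, `L = π(2 + 2C₁c₀²)/(2c'/π)`:
`S ≤ 2·(π/(2c'))Wγ^h + 2(L + π/4)·¾w_m` (radial localisation + chord of the Fermi curve over the angular
window) and `|k⃗'·n⃗_h(θ₀)| ≤ (Wγ^h + (2 + C₂c₀²)S²)/(2c'/π)` (the normal is the normalised gradient at
`p⃗_F`, transversality `∇ε_h·e⃗_r ≥ 2c'/π`, and `∇ε_h(p⃗_F)·k⃗' = ε_h(q⃗) - μ + O(S²)`).  For the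
anisotropic sectors `w_m = πγ^{h/2}` this is the printed box; cf. `box_aniso`.
[cite: BenfattoGiulianiMastropietro2006, §2.5 (2.46)–(2.47) p0010:L55–L67] -/
theorem box_of_support (hI : BGMInitial E) (hSy : BGMSymmetry E) (hS : BGMSmoothness β U C hβ E)
    (he : 0 < e₀) (hβpos : 0 < β) (hh₁ : hβ ≤ h) (hh₀ : h ≤ 0) (hU : |U| ≤ c₀) (hUh : |U| * |(hβ : ℝ)| ≤ c₀)
    (hμ₁ : -4 < μ) (hK₀ : |C 0| * c₀ ≤ 3 / 16 * e₀) (hK₁ : 2 * |C 1| * c₀ ^ 2 ≤ 1 / 2)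
    (hK₂' : 2 * (4 * |C 2| * c₀ ^ 2) * (2 * |C 0| * c₀ + 2 * e₀) ≤ 1)
    (hgap : μ + e₀ + 2 * |C 0| * c₀ < -2 - Real.sqrt 2)
    (hgap' : 2 * |C 0| * c₀ ≤ (μ + 4 - e₀) / 2) (he4 : e₀ < μ + 4)
    (hδ₁ : 2 * (2 * |C 1| * c₀ ^ 2) ≤ 2 / π * Real.sqrt ((μ + 4 - e₀) / 2))
    {m ω : ℕ} {j : ℤ} {q : Fin 2 → ℝ} (hq : q 0 ^ 2 + q 1 ^ 2 < (3 * π / 4) ^ 2)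
    (hF : bgmSectorFn e₀ μ E h m ω (fermiMatsubara β j, q) ≠ 0) :
    (|(q - levelRadius (bgmEffDisp β E h) μ (sectorCenter m ω) • dir (sectorCenter m ω)) 0| +
      |(q - levelRadius (bgmEffDisp β E h) μ (sectorCenter m ω) • dir (sectorCenter m ω)) 1| ≤
      2 * (π / (2 * Real.sqrt ((μ + 4 - e₀) / 2)) * ((1 + 32 * |C 1| * c₀ ^ 2) * (e₀ * (4 : ℝ) ^ h))) +
      2 * (π * (2 + 2 * |C 1| * c₀ ^ 2) / (2 / π * Real.sqrt ((μ + 4 - e₀) / 2)) + π / 4) *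
        (3 * sectorWidth m / 4)) ∧
    |dot2 (q - levelRadius (bgmEffDisp β E h) μ (sectorCenter m ω) • dir (sectorCenter m ω))
        (polarNormal (levelRadius (bgmEffDisp β E h) μ) (sectorCenter m ω))| ≤
      ((1 + 32 * |C 1| * c₀ ^ 2) * (e₀ * (4 : ℝ) ^ h) + (2 + |C 2| * c₀ ^ 2) *
        (|(q - levelRadius (bgmEffDisp β E h) μ (sectorCenter m ω) • dir (sectorCenter m ω)) 0| +
          |(q - levelRadius (bgmEffDisp β E h) μ (sectorCenter m ω) • dir (sectorCenter m ω)) 1|) ^ 2) /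
        (2 / π * Real.sqrt ((μ + 4 - e₀) / 2)) := by
  have hπ := Real.pi_pos
  have hc'0 : 0 < Real.sqrt ((μ + 4 - e₀) / 2) := Real.sqrt_pos.2 (by linarith)
  have hc₀ : 0 ≤ c₀ := (abs_nonneg U).trans hU
  -- support data, curve data, perturbation data (all in unfolded form)
  obtain ⟨hρpos, hρlt, hqrep, -, hj, hwin, kk, hang⟩ :=
    support_polar hI hSy hS he hβpos hh₁ hh₀ hU hUh hμ₁ hK₀ hK₁ hK₂' hgap hgap' he4 hq hF
  obtain ⟨hroot₀, hcu₀, -, hud₀, hslope₀, hlip⟩ :=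
    fermiCurve_data hI hS hh₁ hh₀ hU hUh he hgap hgap' he4 hδ₁ (sectorCenter m ω)
  obtain ⟨hε2, -, -, h2⟩ := bgmEffDisp_perturbation_small hI hS hh₁ hh₀ hU hUh
  have hlevel : ∀ ϑ, bgmEffDisp β E h (levelRadius (bgmEffDisp β E h) μ ϑ • dir ϑ) = μ := fun ϑ =>
    (fermiCurve_data hI hS hh₁ hh₀ hU hUh he hgap hgap' he4 hδ₁ ϑ).1.2
  have hf : bgmShell e₀ μ E h (fermiMatsubara β j, ‖momToComplex q‖ • dir (polarAngle q)) ≠ 0 := by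
    rw [← hqrep]; exact left_ne_zero_of_mul hF
  have hρI : ‖momToComplex q‖ ∈ Ioo (0 : ℝ) (3 * π / 4) := ⟨hρpos, by linarith⟩
  have hR := abs_radius_sub_levelRadius_le hI hSy hS he hβpos hh₁ hh₀ hU hUh hμ₁ hK₀ hK₁ hK₂' hgap hgap' he4
    hδ₁ hρI hf
  have hεq := (abs_bgmEffDisp_sub_le_of_window hI hSy hS hβpos hh₁ hh₀ hU he.le hj.le hwin.le).2
  -- abbreviations
  set c' := Real.sqrt ((μ + 4 - e₀) / 2) with hc'
  set ε := bgmEffDisp β E h with hε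
  set u := levelRadius ε μ with hu
  set θ₀ := sectorCenter m ω with hθ₀
  set p := u θ₀ • dir θ₀ with hp
  set W := (1 + 32 * |C 1| * c₀ ^ 2) * (e₀ * (4 : ℝ) ^ h) with hW
  set L := π * (2 + 2 * |C 1| * c₀ ^ 2) / (2 / π * c') with hL
  set ρ := ‖momToComplex q‖ with hρ
  set θq := polarAngle q with hθq
  set θ' := θq - 2 * π * kk with hθ'
  -- the angular window around the centre, and the representative angle `θ'`
  have hω : (((ω : ℤ) : ℝ) + 1 / 2) * sectorWidth m = θ₀ := by rw [hθ₀, sectorCenter]; push_cast; ring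
  have hang' : |θ' - θ₀| < 3 * sectorWidth m / 4 := by
    rw [hω] at hang
    rw [hθ', show θq - 2 * π * kk - θ₀ = θq - θ₀ - 2 * π * kk by ring]
    exact hang
  have hdir : dir θ' = dir θq := by rw [hθ']; exact dir_sub_two_pi_mul θq kk
  have hu' : u θ' = u θq := levelRadius_congr fun t => by rw [hdir]
  have hupos : 0 < u θ₀ := hc'0.trans_le hcu₀
  have hR' : |ρ - u θ'| ≤ π / (2 * c') * W := by rw [hu']; exact hR
  -- the `ℓ¹` bound on `k' = (ρ - u θ')e⃗_r(θ') + (u θ' e⃗_r(θ') - u θ₀ e⃗_r(θ₀))`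
  have hk' : q - p = (ρ - u θ') • dir θ' + (u θ' • dir θ' - u θ₀ • dir θ₀) := by
    rw [hqrep, ← hdir, hp, sub_smul]; abel
  have hcomp : ∀ i : Fin 2, |(q - p) i| ≤ |ρ - u θ'| + (L * |θ' - θ₀| + u θ₀ * |θ' - θ₀|) := by
    intro i
    rw [hk', Pi.add_apply]
    refine (abs_add_le _ _).trans (add_le_add ?_ ?_)
    · rw [Pi.smul_apply, smul_eq_mul, abs_mul]
      exact (mul_le_mul_of_nonneg_left (abs_dir_le_one θ' i) (abs_nonneg _)).trans (by rw [mul_one])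
    · exact (abs_polarCurve_sub_apply_le hupos.le θ' i).trans (add_le_add (hlip θ' θ₀) le_rfl)
  have hS : |(q - p) 0| + |(q - p) 1| ≤ 2 * (π / (2 * c') * W) + 2 * (L + π / 4) * (3 * sectorWidth m / 4) := by
    have h0 := hcomp 0
    have h1 := hcomp 1
    have hL0 : 0 ≤ L := by rw [hL]; positivity
    have hθle : |θ' - θ₀| ≤ 3 * sectorWidth m / 4 := hang'.le
    have hu₀le : u θ₀ ≤ π / 4 := by
      have := (fermiCurve_data hI hS hh₁ hh₀ hU hUh he hgap hgap' he4 hδ₁ θ₀).2.2.1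
      exact this.le
    have hLθ : L * |θ' - θ₀| + u θ₀ * |θ' - θ₀| ≤ (L + π / 4) * (3 * sectorWidth m / 4) := by
      rw [← add_mul]
      exact mul_le_mul (by linarith) hθle (abs_nonneg _) (by positivity)
    linarith
  refine ⟨hS, ?_⟩
  -- the normal coordinate through the gradient at `p`
  have hεd : Differentiable ℝ ε := hε2.differentiable (by simp)
  have hm0 : 0 < 2 / π * c' := by positivity
  have ha : 0 < fderiv ℝ ε p (dir θ₀) := hm0.trans_le hslope₀
  have hn : |dot2 (q - p) (polarNormal u θ₀)| ≤ |fderiv ℝ ε p (q - p)| / fderiv ℝ ε p (dir θ₀) :=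
    abs_dot2_polarNormal_le_of_level hεd hud₀ hlevel hupos ha (q - p)
  -- `∇ε(p)·k' = ε(q) - μ - Taylor remainder`
  have htay := abs_taylor_two_le hε2 h2 p q
  have hεp : ε p = μ := hroot₀.2
  have hgrad : |fderiv ℝ ε p (q - p)| ≤ W + (2 + |C 2| * c₀ ^ 2) * (|(q - p) 0| + |(q - p) 1|) ^ 2 := by
    have e : fderiv ℝ ε p (q - p) = (ε q - μ) - (ε q - ε p - fderiv ℝ ε p (q - p)) := by rw [hεp]; ring
    rw [e]
    exact (abs_sub _ _).trans (add_le_add hεq htay)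
  calc |dot2 (q - p) (polarNormal u θ₀)| ≤ |fderiv ℝ ε p (q - p)| / fderiv ℝ ε p (dir θ₀) := hn
    _ ≤ |fderiv ℝ ε p (q - p)| / (2 / π * c') := div_le_div_of_nonneg_left (abs_nonneg _) hm0 hslope₀
    _ ≤ _ := div_le_div_of_nonneg_right hgrad hm0.le

/-- **(2.53)–(2.54) for the effective dispersion**: on the support,
`|∂_{k'₂}ε_h(q⃗)| = |∇ε_h(q⃗)·τ⃗_h(θ₀)| ≤ 2(2 + C₂c₀²)S` with `S = |k⃗'|₁ = O(γ^{h/2})` — since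
`∇ε_h(p⃗_F)·τ⃗_h(θ₀) = 0` exactly and the gradient moves by at most `(2 + C₂c₀²)|k⃗'|₁` along the segment
(BGM: "`∂ε_h/∂k'₂ = |∇ε_h(k⃗)| sin(θ - θ_{h,ω}) + O(γ^h) = O(γ^{h/2})`").  Valid for EVERY `q⃗` (no support
hypothesis). [cite: BenfattoGiulianiMastropietro2006, §2.5 proof of Lemma 2.2 (2.53)–(2.54) p0010:L136–L154] -/
theorem abs_fderiv_bgmEffDisp_polarTangent_le (hI : BGMInitial E) (hS : BGMSmoothness β U C hβ E)
    (hh₁ : hβ ≤ h) (hh₀ : h ≤ 0) (hU : |U| ≤ c₀) (hUh : |U| * |(hβ : ℝ)| ≤ c₀) (he : 0 < e₀)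
    (hgap : μ + e₀ + 2 * |C 0| * c₀ < -2 - Real.sqrt 2) (hgap' : 2 * |C 0| * c₀ ≤ (μ + 4 - e₀) / 2) (he4 : e₀ < μ + 4)
    (hδ₁ : 2 * (2 * |C 1| * c₀ ^ 2) ≤ 2 / π * Real.sqrt ((μ + 4 - e₀) / 2)) (θ₀ : ℝ) (q : Fin 2 → ℝ) :
    |fderiv ℝ (bgmEffDisp β E h) q (polarTangent (levelRadius (bgmEffDisp β E h) μ) θ₀)| ≤
      2 * (2 + |C 2| * c₀ ^ 2) *
        (|(q - levelRadius (bgmEffDisp β E h) μ θ₀ • dir θ₀) 0| + |(q - levelRadius (bgmEffDisp β E h) μ θ₀ • dir θ₀) 1|) := by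
  obtain ⟨-, hcu₀, -, hud₀, -, -⟩ := fermiCurve_data hI hS hh₁ hh₀ hU hUh he hgap hgap' he4 hδ₁ θ₀
  obtain ⟨hε2, -, -, h2⟩ := bgmEffDisp_perturbation_small hI hS hh₁ hh₀ hU hUh
  have hlevel : ∀ ϑ, bgmEffDisp β E h (levelRadius (bgmEffDisp β E h) μ ϑ • dir ϑ) = μ := fun ϑ =>
    (fermiCurve_data hI hS hh₁ hh₀ hU hUh he hgap hgap' he4 hδ₁ ϑ).1.2
  have hc'0 : 0 < Real.sqrt ((μ + 4 - e₀) / 2) := Real.sqrt_pos.2 (by linarith)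
  set ε := bgmEffDisp β E h with hε
  set u := levelRadius ε μ with hu
  set p := u θ₀ • dir θ₀ with hp
  have hεd : Differentiable ℝ ε := hε2.differentiable (by simp)
  have hupos : 0 < u θ₀ := hc'0.trans_le hcu₀
  have h0 : fderiv ℝ ε p (polarTangent u θ₀) = 0 := fderiv_polarTangent_eq_zero hεd hud₀ hlevel
  have hinc := abs_fderiv_sub_fderiv_le hε2 h2 p q (polarTangent u θ₀)
  rw [h0, sub_zero] at hinc
  have hτ : |polarTangent u θ₀ 0| + |polarTangent u θ₀ 1| ≤ 2 := by
    have := abs_polarTangent_apply_le_one u θ₀ hupos 0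
    have := abs_polarTangent_apply_le_one u θ₀ hupos 1
    linarith
  have hδ : 0 ≤ (2 + |C 2| * c₀ ^ 2) * (|(q - p) 0| + |(q - p) 1|) := by positivity
  calc _ ≤ (2 + |C 2| * c₀ ^ 2) * (|(q - p) 0| + |(q - p) 1|) * (|polarTangent u θ₀ 0| + |polarTangent u θ₀ 1|) := hinc
    _ ≤ (2 + |C 2| * c₀ ^ 2) * (|(q - p) 0| + |(q - p) 1|) * 2 := mul_le_mul_of_nonneg_left hτ hδ
    _ = _ := by ring

end Box

/-! ### §7 The tangential gradient of the dispersion slices on the support: (2.53) -/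

section Slices

variable {μ e₀ β U c₀ : ℝ} {C : ℕ → ℝ} {hβ : ℤ} {E : ℤ → ℝ × (Fin 2 → ℝ) → ℂ} {h : ℤ}

/-- `-π/β ∈ D_β`. [folklore] -/
private theorem neg_pi_div_mem_matsubaraSet' (β : ℝ) : -(π / β) ∈ matsubaraSet β :=
  ⟨-1, by simp [fermiMatsubara]; ring⟩

/-- `U²h'² ≤ 4c₀²` for `h - 1 ≤ h' ≤ 0`, `h_β ≤ h`, under the coupled smallness. [folklore] -/
private theorem U_sq_mul_sq_le_four (hh₁ : hβ ≤ h) (hh₀ : h ≤ 0) (hU : |U| ≤ c₀) (hUh : |U| * |(hβ : ℝ)| ≤ c₀)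
    {h' : ℤ} (hh'₁ : h - 1 ≤ h') (hh'₀ : h' ≤ 0) : U ^ 2 * (h' : ℝ) ^ 2 ≤ 4 * c₀ ^ 2 := by
  have h1 := abs_U_mul_abs_le hh₁ hh₀ hUh
  have hc₀ : 0 ≤ c₀ := (abs_nonneg U).trans hU
  have h2 : |U| * |(h' : ℝ)| ≤ 2 * c₀ := by
    have : |(h' : ℝ)| ≤ |(h : ℝ)| + 1 := by
      rw [abs_of_nonpos (by exact_mod_cast hh'₀), abs_of_nonpos (by exact_mod_cast hh₀)]
      have : ((h : ℝ)) - 1 ≤ h' := by exact_mod_cast hh'₁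
      linarith
    calc |U| * |(h' : ℝ)| ≤ |U| * (|(h : ℝ)| + 1) := mul_le_mul_of_nonneg_left this (abs_nonneg U)
      _ = |U| * |(h : ℝ)| + |U| := by ring
      _ ≤ c₀ + c₀ := add_le_add h1 hU
      _ = 2 * c₀ := by ring
  have h3 : (|U| * |(h' : ℝ)|) ^ 2 ≤ (2 * c₀) ^ 2 := pow_le_pow_left₀ (by positivity) h2 2
  calc U ^ 2 * (h' : ℝ) ^ 2 = (|U| * |(h' : ℝ)|) ^ 2 := by rw [mul_pow, sq_abs, sq_abs]
    _ ≤ (2 * c₀) ^ 2 := h3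
    _ = 4 * c₀ ^ 2 := by ring

/-- **The gradient of `E_{h'}(π/β, ·) - ε_{h'}`** (`= i Im E_{h'}(π/β, ·) = (π/β)∂_{k₀}E_{h'}(-π/β, ·)`):
`‖∇[E_{h'}(π/β,·) - ε_{h'}](q⃗)·v⃗‖ ≤ (π/β)C₂U²h'²|v⃗|₁` (mixed derivatives of (2.36)).
[cite: BenfattoGiulianiMastropietro2006, §2.4 (2.42)–(2.44) p0009:L101–p0010:L4] -/
theorem norm_fderiv_E_pi_div_sub_bgmEffDisp_le (hI : BGMInitial E) (hSy : BGMSymmetry E)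
    (hS : BGMSmoothness β U C hβ E) (hβpos : 0 < β) {h' : ℤ} (hh₁ : hβ - 1 ≤ h') (hh₀ : h' ≤ 0)
    (q v : Fin 2 → ℝ) :
    ‖fderiv ℝ (fun q => E h' (π / β, q) - ((bgmEffDisp β E h' q : ℝ) : ℂ)) q v‖ ≤
      π / β * (|C 2| * U ^ 2 * (h' : ℝ) ^ 2 * (|v 0| + |v 1|)) := by
  have hfun : (fun q => E h' (π / β, q) - ((bgmEffDisp β E h' q : ℝ) : ℂ)) =
      fun q => ((π / β : ℝ)) • bgmTimeDiffIter β 1 (E h') (-(π / β), q) :=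
    funext fun q => E_pi_div_sub_bgmEffDisp hSy hβpos h' q
  have hk₀ := neg_pi_div_mem_matsubaraSet' β
  obtain ⟨hTd, -⟩ := norm_fderiv_bgmTimeDiffIter_one_le hI hS hh₁ hh₀ hk₀ q 0
  have hb : ∀ l : Fin 2, ‖fderiv ℝ (fun k' => bgmTimeDiffIter β 1 (E h') (-(π / β), k')) q (Pi.single l 1)‖ ≤
      |C 2| * U ^ 2 * (h' : ℝ) ^ 2 := fun l => (norm_fderiv_bgmTimeDiffIter_one_le hI hS hh₁ hh₀ hk₀ q l).2
  rw [hfun, (hTd.hasFDerivAt.fun_const_smul ((π / β : ℝ))).fderiv]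
  rw [FunLike.coe_smul, Pi.smul_apply, norm_smul, Real.norm_eq_abs,
    abs_of_pos (by positivity : (0 : ℝ) < π / β)]
  exact mul_le_mul_of_nonneg_left (norm_clm_apply_le_of_basis _ (hb 0) (hb 1) v) (by positivity)

/-- **The gradient of `ε_{h-1} - ε_h`**: `|∇(ε_{h-1} - ε_h)(q⃗)·v⃗| ≤ C₁U²|h|γ^h|v⃗|₁` ((2.36), `n = 1`, at
`k₀ = π/β`). [cite: BenfattoGiulianiMastropietro2006, §2.3 (2.36) p0008:L46, §2.4 (2.41a) p0009:L77] -/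
theorem abs_fderiv_bgmEffDisp_sub_le (hSy : BGMSymmetry E) (hS : BGMSmoothness β U C hβ E) (hh₁ : hβ ≤ h)
    (hh₀ : h ≤ 0) (q v : Fin 2 → ℝ) :
    |fderiv ℝ (bgmEffDisp β E (h - 1)) q v - fderiv ℝ (bgmEffDisp β E h) q v| ≤
      |C 1| * U ^ 2 * (|(h : ℝ)| * (4 : ℝ) ^ h) * (|v 0| + |v 1|) := by
  have hS1 := hS.1
  set m := (-h).toNat with hm
  have hmz : (m : ℤ) = -h := Int.toNat_of_nonneg (by omega)
  have hm1 : -(m : ℤ) = h := by omega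
  have hk₀ : π / β ∈ matsubaraSet β := ⟨0, by simp [fermiMatsubara]⟩
  obtain ⟨-, hb, -⟩ := bgm_diff_bounds hS (m := m) (by omega) hk₀ q
  rw [hm1] at hb
  -- `ε_{h'} = Re E_{h'}(π/β, ·)`
  have hεfun : ∀ h'' : ℤ, bgmEffDisp β E h'' = fun q => (E h'' (π / β, q)).re := fun h'' =>
    funext fun q => bgmEffDisp_eq_re hSy β h'' q
  set g : (Fin 2 → ℝ) → ℂ := fun k => E h (π / β, k) - E (h - 1) (π / β, k) with hg
  have hgd : Differentiable ℝ g :=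
    ((hS1 h (π / β) 1).differentiable (by simp)).sub ((hS1 (h - 1) (π / β) 1).differentiable (by simp))
  have hdiff : (fun q => bgmEffDisp β E (h - 1) q - bgmEffDisp β E h q) = fun q => -(g q).re := by
    funext q; rw [hεfun, hεfun]; simp [hg]
  have hd1 : Differentiable ℝ (bgmEffDisp β E (h - 1)) := by
    rw [hεfun]; exact Complex.reCLM.differentiable.comp ((hS1 _ _ 1).differentiable (by simp))
  have hd0 : Differentiable ℝ (bgmEffDisp β E h) := by
    rw [hεfun]; exact Complex.reCLM.differentiable.comp ((hS1 _ _ 1).differentiable (by simp))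
  have hsub : fderiv ℝ (bgmEffDisp β E (h - 1)) q v - fderiv ℝ (bgmEffDisp β E h) q v =
      fderiv ℝ (fun q => bgmEffDisp β E (h - 1) q - bgmEffDisp β E h q) q v := by
    rw [fderiv_fun_sub (hd1 q) (hd0 q)]; rfl
  have hre : HasFDerivAt (fun q => -(g q).re) (-(Complex.reCLM.comp (fderiv ℝ g q))) q :=
    (Complex.reCLM.hasFDerivAt.comp q (hgd q).hasFDerivAt).neg
  rw [hsub, hdiff, hre.fderiv]
  simp only [neg_apply, ContinuousLinearMap.comp_apply, Complex.reCLM_apply, abs_neg]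
  refine (Complex.abs_re_le_norm _).trans ((norm_clm_apply_le_of_basis _ (hb 0) (hb 1) v).trans (le_of_eq ?_))
  have hmr : (m : ℝ) = |(h : ℝ)| := by
    have : (m : ℝ) = -(h : ℝ) := by exact_mod_cast hmz
    rw [this, abs_of_nonpos (by exact_mod_cast hh₀)]
  rw [hmr]

/-- **The slices `E_{h'}(k₀(j), ·)` versus `ε_h`, gradients** (`h' = h` or `h' = h - 1`): for a frequency
of the support, `|k₀(j)| ≤ 8e₀γ^h`,
`‖∇E_{h'}(k₀(j), ·)(q⃗)·v⃗ - ∇ε_h(q⃗)·v⃗‖ ≤ (24e₀·4C₂ + C₁)c₀²γ^h|v⃗|₁` — the three differences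
`E_{h'}(k₀,·) - E_{h'}(π/β,·)` (discrete mean value), `E_{h'}(π/β,·) - ε_{h'}` ((2.44)), `ε_{h-1} - ε_h`
((2.36)) all have gradients `O(γ^h)`: BGM's "`|∂_{k'₂}[(E_{h-1}(k) - E_h(k)) + (E_h(k) - ε_h(k⃗))]| ≤ Cγ^h`",
valid in every direction. [cite: BenfattoGiulianiMastropietro2006, §2.5 proof of Lemma 2.2 (2.53) p0010:L136–L145] -/
theorem norm_fderiv_slice_sub_fderiv_bgmEffDisp_le (hI : BGMInitial E) (hSy : BGMSymmetry E)
    (hS : BGMSmoothness β U C hβ E) (hβpos : 0 < β) (hh₁ : hβ ≤ h) (hh₀ : h ≤ 0) (hU : |U| ≤ c₀)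
    (hUh : |U| * |(hβ : ℝ)| ≤ c₀) (he : 0 ≤ e₀) {h' : ℤ} (hh' : h' = h ∨ h' = h - 1)
    {j : ℤ} (hj : |fermiMatsubara β j| ≤ 8 * e₀ * (4 : ℝ) ^ h) (q v : Fin 2 → ℝ) :
    ‖fderiv ℝ (fun q => E h' (fermiMatsubara β j, q)) q v - ((fderiv ℝ (bgmEffDisp β E h) q v : ℝ) : ℂ)‖ ≤
      (96 * e₀ * |C 2| + |C 1|) * c₀ ^ 2 * (4 : ℝ) ^ h * (|v 0| + |v 1|) := by
  have hS1 := hS.1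
  have hπβ : π / β ≤ 8 * e₀ * (4 : ℝ) ^ h := (pi_div_le_abs_fermiMatsubara hβpos j).trans hj
  have h4 : (0 : ℝ) < (4 : ℝ) ^ h := zpow_pos (by norm_num) _
  have h41 : (4 : ℝ) ^ h ≤ 1 := zpow_le_one_of_nonpos₀ (by norm_num) hh₀
  have hc₀ : 0 ≤ c₀ := (abs_nonneg U).trans hU
  have hv : 0 ≤ |v 0| + |v 1| := by positivity
  have hh'₁ : h - 1 ≤ h' := by rcases hh' with rfl | rfl <;> omega
  have hh'₀ : h' ≤ 0 := by rcases hh' with rfl | rfl <;> omega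
  have hUh' := U_sq_mul_sq_le_four hh₁ hh₀ hU hUh hh'₁ hh'₀
  -- the three differences
  have hA := norm_fderiv_E_sub_fderiv_E_pi_div_le hI hS hβpos (h' := h') (by omega) hh'₀ j q v
  have hB := norm_fderiv_E_pi_div_sub_bgmEffDisp_le hI hSy hS hβpos (h' := h') (by omega) hh'₀ q v
  -- differentiability bookkeeping
  have hεfun : ∀ h'' : ℤ, bgmEffDisp β E h'' = fun q => (E h'' (π / β, q)).re := fun h'' =>
    funext fun q => bgmEffDisp_eq_re hSy β h'' q
  have hdε : ∀ h'' : ℤ, Differentiable ℝ (bgmEffDisp β E h'') := fun h'' => by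
    rw [hεfun]; exact Complex.reCLM.differentiable.comp ((hS1 _ _ 1).differentiable (by simp))
  have hdE : ∀ (h'' : ℤ) (k₀ : ℝ), Differentiable ℝ (fun q => E h'' (k₀, q)) := fun h'' k₀ =>
    (hS1 h'' k₀ 1).differentiable (by simp)
  have hdεC : ∀ h'' : ℤ, Differentiable ℝ (fun q => ((bgmEffDisp β E h'' q : ℝ) : ℂ)) := fun h'' =>
    Complex.ofRealCLM.differentiable.comp (hdε h'')
  have hfdεC : ∀ h'' : ℤ, fderiv ℝ (fun q => ((bgmEffDisp β E h'' q : ℝ) : ℂ)) q v =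
      ((fderiv ℝ (bgmEffDisp β E h'') q v : ℝ) : ℂ) := fun h'' => by
    rw [show (fun q => ((bgmEffDisp β E h'' q : ℝ) : ℂ)) = Complex.ofRealCLM ∘ bgmEffDisp β E h'' from rfl,
      fderiv_comp q Complex.ofRealCLM.differentiableAt (hdε h'' q), Complex.ofRealCLM.fderiv]
    rfl
  -- `∇E_{h'}(k₀ j) - ∇ε_h = [∇E_{h'}(k₀ j) - ∇E_{h'}(π/β)] + ∇[E_{h'}(π/β) - ε_{h'}] + ∇[ε_{h'} - ε_h]`
  have hsplit : fderiv ℝ (fun q => E h' (fermiMatsubara β j, q)) q v - ((fderiv ℝ (bgmEffDisp β E h) q v : ℝ) : ℂ) =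
      (fderiv ℝ (fun q => E h' (fermiMatsubara β j, q)) q v - fderiv ℝ (fun q => E h' (π / β, q)) q v) +
      fderiv ℝ (fun q => E h' (π / β, q) - ((bgmEffDisp β E h' q : ℝ) : ℂ)) q v +
      (((fderiv ℝ (bgmEffDisp β E h') q v : ℝ) : ℂ) - ((fderiv ℝ (bgmEffDisp β E h) q v : ℝ) : ℂ)) := by
    rw [fderiv_fun_sub ((hdE h' _) q) ((hdεC h') q)]
    simp only [sub_apply]
    rw [hfdεC]
    ring
  rw [hsplit]
  have hthird : ‖((fderiv ℝ (bgmEffDisp β E h') q v : ℝ) : ℂ) - ((fderiv ℝ (bgmEffDisp β E h) q v : ℝ) : ℂ)‖ ≤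
      |C 1| * c₀ ^ 2 * (4 : ℝ) ^ h * (|v 0| + |v 1|) := by
    rw [← Complex.ofReal_sub, Complex.norm_real, Real.norm_eq_abs]
    rcases hh' with rfl | rfl
    · rw [sub_self, abs_zero]; positivity
    · refine (abs_fderiv_bgmEffDisp_sub_le hSy hS hh₁ hh₀ q v).trans ?_
      have : U ^ 2 * |(h : ℝ)| ≤ c₀ ^ 2 := by
        have h1 := abs_U_mul_abs_le hh₁ hh₀ hUh
        calc U ^ 2 * |(h : ℝ)| = |U| * (|U| * |(h : ℝ)|) := by rw [← sq_abs]; ring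
          _ ≤ c₀ * c₀ := mul_le_mul hU h1 (by positivity) hc₀
          _ = c₀ ^ 2 := by ring
      calc |C 1| * U ^ 2 * (|(h : ℝ)| * (4 : ℝ) ^ h) * (|v 0| + |v 1|)
          = |C 1| * (U ^ 2 * |(h : ℝ)|) * (4 : ℝ) ^ h * (|v 0| + |v 1|) := by ring
        _ ≤ |C 1| * c₀ ^ 2 * (4 : ℝ) ^ h * (|v 0| + |v 1|) := by gcongr
  have hfirst : ‖fderiv ℝ (fun q => E h' (fermiMatsubara β j, q)) q v - fderiv ℝ (fun q => E h' (π / β, q)) q v‖ ≤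
      64 * e₀ * |C 2| * c₀ ^ 2 * (4 : ℝ) ^ h * (|v 0| + |v 1|) := by
    refine hA.trans ?_
    have h2 := abs_fermiMatsubara_sub_le hβpos j
    calc |fermiMatsubara β j - π / β| * (|C 2| * U ^ 2 * (h' : ℝ) ^ 2 * (|v 0| + |v 1|))
        = |fermiMatsubara β j - π / β| * (|C 2| * (U ^ 2 * (h' : ℝ) ^ 2) * (|v 0| + |v 1|)) := by ring
      _ ≤ (2 * (8 * e₀ * (4 : ℝ) ^ h)) * (|C 2| * (4 * c₀ ^ 2) * (|v 0| + |v 1|)) := by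
          refine mul_le_mul (h2.trans (by linarith)) (by gcongr) (by positivity) (by positivity)
      _ = _ := by ring
  have hsecond : ‖fderiv ℝ (fun q => E h' (π / β, q) - ((bgmEffDisp β E h' q : ℝ) : ℂ)) q v‖ ≤
      32 * e₀ * |C 2| * c₀ ^ 2 * (4 : ℝ) ^ h * (|v 0| + |v 1|) := by
    refine hB.trans ?_
    calc π / β * (|C 2| * U ^ 2 * (h' : ℝ) ^ 2 * (|v 0| + |v 1|))
        = π / β * (|C 2| * (U ^ 2 * (h' : ℝ) ^ 2) * (|v 0| + |v 1|)) := by ring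
      _ ≤ (8 * e₀ * (4 : ℝ) ^ h) * (|C 2| * (4 * c₀ ^ 2) * (|v 0| + |v 1|)) := by
          refine mul_le_mul hπβ (by gcongr) (by positivity) (by positivity)
      _ = _ := by ring
  calc _ ≤ ‖fderiv ℝ (fun q => E h' (fermiMatsubara β j, q)) q v - fderiv ℝ (fun q => E h' (π / β, q)) q v‖ +
        ‖fderiv ℝ (fun q => E h' (π / β, q) - ((bgmEffDisp β E h' q : ℝ) : ℂ)) q v‖ +
        ‖((fderiv ℝ (bgmEffDisp β E h') q v : ℝ) : ℂ) - ((fderiv ℝ (bgmEffDisp β E h) q v : ℝ) : ℂ)‖ :=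
        norm_add₃_le
    _ ≤ 64 * e₀ * |C 2| * c₀ ^ 2 * (4 : ℝ) ^ h * (|v 0| + |v 1|) +
        32 * e₀ * |C 2| * c₀ ^ 2 * (4 : ℝ) ^ h * (|v 0| + |v 1|) +
        |C 1| * c₀ ^ 2 * (4 : ℝ) ^ h * (|v 0| + |v 1|) := add_le_add (add_le_add hfirst hsecond) hthird
    _ = _ := by ring

/-- **(2.53): the tangential gradient of `E_{h'}` on the support**, `h' ∈ {h, h-1}`: if `|q⃗| < 3π/4` and
`F_{h,ω}(k₀(j), q⃗) ≠ 0` then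
`‖∂_{k'₂}E_{h'}(k₀(j), q⃗)‖ = ‖∇E_{h'}(k₀(j),·)(q⃗)·τ⃗_h(θ₀)‖ ≤ 2(2 + C₂c₀²)|k⃗'|₁ + 2(96e₀C₂ + C₁)c₀²γ^h`
(`= O(γ^{h/2})` by the box), BGM: "`|∂E_{h-1}(k)/∂k'₂| ≤ Cγ^{h/2}`".
[cite: BenfattoGiulianiMastropietro2006, §2.5 proof of Lemma 2.2 (2.53)–(2.54) p0010:L129–L154] -/
theorem norm_fderiv_slice_polarTangent_le (hI : BGMInitial E) (hSy : BGMSymmetry E)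
    (hS : BGMSmoothness β U C hβ E) (he : 0 < e₀) (hβpos : 0 < β) (hh₁ : hβ ≤ h) (hh₀ : h ≤ 0)
    (hU : |U| ≤ c₀) (hUh : |U| * |(hβ : ℝ)| ≤ c₀) (hμ₁ : -4 < μ) (hK₀ : |C 0| * c₀ ≤ 3 / 16 * e₀)
    (hK₁ : 2 * |C 1| * c₀ ^ 2 ≤ 1 / 2) (hK₂' : 2 * (4 * |C 2| * c₀ ^ 2) * (2 * |C 0| * c₀ + 2 * e₀) ≤ 1)
    (hgap : μ + e₀ + 2 * |C 0| * c₀ < -2 - Real.sqrt 2) (hgap' : 2 * |C 0| * c₀ ≤ (μ + 4 - e₀) / 2)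
    (he4 : e₀ < μ + 4) (hδ₁ : 2 * (2 * |C 1| * c₀ ^ 2) ≤ 2 / π * Real.sqrt ((μ + 4 - e₀) / 2))
    {h' : ℤ} (hh' : h' = h ∨ h' = h - 1)
    {m : ℕ} {ω j : ℤ} {q : Fin 2 → ℝ} (hq : q 0 ^ 2 + q 1 ^ 2 < (3 * π / 4) ^ 2)
    (hF : bgmSectorFn e₀ μ E h m ω (fermiMatsubara β j, q) ≠ 0) (θ₀ : ℝ) :
    ‖fderiv ℝ (fun q => E h' (fermiMatsubara β j, q)) q (polarTangent (levelRadius (bgmEffDisp β E h) μ) θ₀)‖ ≤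
      2 * (2 + |C 2| * c₀ ^ 2) *
        (|(q - levelRadius (bgmEffDisp β E h) μ θ₀ • dir θ₀) 0| + |(q - levelRadius (bgmEffDisp β E h) μ θ₀ • dir θ₀) 1|) +
      2 * ((96 * e₀ * |C 2| + |C 1|) * c₀ ^ 2 * (4 : ℝ) ^ h) := by
  obtain ⟨-, -, -, -, hj, -, -⟩ :=
    support_polar hI hSy hS he hβpos hh₁ hh₀ hU hUh hμ₁ hK₀ hK₁ hK₂' hgap hgap' he4 hq hF
  set τ := polarTangent (levelRadius (bgmEffDisp β E h) μ) θ₀ with hτ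
  have hcmp := norm_fderiv_slice_sub_fderiv_bgmEffDisp_le hI hSy hS hβpos hh₁ hh₀ hU hUh he.le hh' hj.le q τ
  have hε := abs_fderiv_bgmEffDisp_polarTangent_le hI hS hh₁ hh₀ hU hUh he hgap hgap' he4 hδ₁ θ₀ q
  obtain ⟨-, hcu₀, -, -, -, -⟩ := fermiCurve_data hI hS hh₁ hh₀ hU hUh he hgap hgap' he4 hδ₁ θ₀
  have hc'0 : 0 < Real.sqrt ((μ + 4 - e₀) / 2) := Real.sqrt_pos.2 (by linarith)
  have hupos : 0 < levelRadius (bgmEffDisp β E h) μ θ₀ := hc'0.trans_le hcu₀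
  have hτ1 : |τ 0| + |τ 1| ≤ 2 := by
    have := abs_polarTangent_apply_le_one _ θ₀ hupos 0
    have := abs_polarTangent_apply_le_one _ θ₀ hupos 1
    rw [hτ]; linarith
  have hG : 0 ≤ (96 * e₀ * |C 2| + |C 1|) * c₀ ^ 2 * (4 : ℝ) ^ h := by positivity
  have hsplit : fderiv ℝ (fun q => E h' (fermiMatsubara β j, q)) q τ =
      (fderiv ℝ (fun q => E h' (fermiMatsubara β j, q)) q τ - ((fderiv ℝ (bgmEffDisp β E h) q τ : ℝ) : ℂ)) +
        ((fderiv ℝ (bgmEffDisp β E h) q τ : ℝ) : ℂ) := by ring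
  rw [hsplit]
  calc _ ≤ ‖fderiv ℝ (fun q => E h' (fermiMatsubara β j, q)) q τ - ((fderiv ℝ (bgmEffDisp β E h) q τ : ℝ) : ℂ)‖ +
        ‖((fderiv ℝ (bgmEffDisp β E h) q τ : ℝ) : ℂ)‖ := norm_add_le _ _
    _ ≤ (96 * e₀ * |C 2| + |C 1|) * c₀ ^ 2 * (4 : ℝ) ^ h * (|τ 0| + |τ 1|) + _ := add_le_add hcmp le_rfl
    _ ≤ (96 * e₀ * |C 2| + |C 1|) * c₀ ^ 2 * (4 : ℝ) ^ h * 2 +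
        2 * (2 + |C 2| * c₀ ^ 2) *
          (|(q - levelRadius (bgmEffDisp β E h) μ θ₀ • dir θ₀) 0| + |(q - levelRadius (bgmEffDisp β E h) μ θ₀ • dir θ₀) 1|) := by
        rw [Complex.norm_real, Real.norm_eq_abs]
        exact add_le_add (mul_le_mul_of_nonneg_left hτ1 hG) hε
    _ = _ := by ring

end Slices

/-! ### §8 The anisotropic sectors: the box and (2.53) packaged with the coupled smallness `c₀` -/

section Package

variable {μ e₀ β U c₀ : ℝ} {C : ℕ → ℝ} {hβ : ℤ} {E : ℤ → ℝ × (Fin 2 → ℝ) → ℂ} {h : ℤ}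

/-- Small positive constants: a continuous constraint vanishing at `0` holds near `0⁺`. [folklore] -/
private theorem eventually_nhdsGT_le_of_continuous {f : ℝ → ℝ} (hf : Continuous f) (h0 : f 0 = 0) {b : ℝ}
    (hb : 0 < b) : ∀ᶠ c in 𝓝[>] (0 : ℝ), f c ≤ b :=
  ((hf.tendsto' 0 0 h0).eventually_le_const hb).filter_mono nhdsWithin_le_nhds

/-- Strict version of `eventually_nhdsGT_le_of_continuous`. [folklore] -/
private theorem eventually_nhdsGT_lt_of_continuous {f : ℝ → ℝ} (hf : Continuous f) (h0 : f 0 = 0) {b : ℝ}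
    (hb : 0 < b) : ∀ᶠ c in 𝓝[>] (0 : ℝ), f c < b :=
  ((hf.tendsto' 0 0 h0).eventually_lt_const hb).filter_mono nhdsWithin_le_nhds

/-- **The coupled-smallness constant of §2.4–§2.5**: for `-4 < μ` and admissible `e₀` there is `c₀ > 0`
satisfying the six polynomial constraints used by `BGM2006Sec2ShellSupport` / `BGM2006Sec2TadpoleProof` and
this file (BGM: "`c₀ = |h_β|U₀` small enough"). [cite: BenfattoGiulianiMastropietro2006, §2.4 Lemma 2.1 (hypothesis) p0009:L39–L43] -/
theorem exists_coupledSmallness (he₀ : BGMAdmissibleE0 μ e₀) (C : ℕ → ℝ) :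
    ∃ c₀ : ℝ, 0 < c₀ ∧ |C 0| * c₀ ≤ 3 / 16 * e₀ ∧ 2 * |C 1| * c₀ ^ 2 ≤ 1 / 2 ∧
      2 * (4 * |C 2| * c₀ ^ 2) * (2 * |C 0| * c₀ + 2 * e₀) ≤ 1 ∧
      μ + e₀ + 2 * |C 0| * c₀ < -2 - Real.sqrt 2 ∧
      2 * |C 0| * c₀ ≤ (μ + 4 - e₀) / 2 ∧
      2 * (2 * |C 1| * c₀ ^ 2) ≤ 2 / π * Real.sqrt ((μ + 4 - e₀) / 2) := by
  obtain ⟨he, he2, he4⟩ := he₀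
  have hπ := Real.pi_pos
  have hc0 : 0 < Real.sqrt ((μ + 4 - e₀) / 2) := Real.sqrt_pos.2 (by linarith)
  obtain ⟨c₀, ⟨hK₀, hK₁, hK₂', hgap, hgap', hδ₁⟩, hc₀pos⟩ :
      ∃ c₀ : ℝ, (|C 0| * c₀ ≤ 3 / 16 * e₀ ∧ 2 * |C 1| * c₀ ^ 2 ≤ 1 / 2 ∧
        2 * (4 * |C 2| * c₀ ^ 2) * (2 * |C 0| * c₀ + 2 * e₀) ≤ 1 ∧
        2 * |C 0| * c₀ < -2 - Real.sqrt 2 - μ - e₀ ∧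
        2 * |C 0| * c₀ ≤ (μ + 4 - e₀) / 2 ∧
        2 * (2 * |C 1| * c₀ ^ 2) ≤ 2 / π * Real.sqrt ((μ + 4 - e₀) / 2)) ∧ 0 < c₀ :=
    (((eventually_nhdsGT_le_of_continuous (f := fun c => |C 0| * c) (by fun_prop) (by simp) (by positivity)).and <|
      (eventually_nhdsGT_le_of_continuous (f := fun c => 2 * |C 1| * c ^ 2) (by fun_prop) (by simp) (by norm_num)).and <|
      (eventually_nhdsGT_le_of_continuous (f := fun c => 2 * (4 * |C 2| * c ^ 2) * (2 * |C 0| * c + 2 * e₀))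
        (by fun_prop) (by simp) one_pos).and <|
      (eventually_nhdsGT_lt_of_continuous (f := fun c => 2 * |C 0| * c) (by fun_prop) (by simp)
        (by linarith : (0 : ℝ) < -2 - Real.sqrt 2 - μ - e₀)).and <|
      (eventually_nhdsGT_le_of_continuous (f := fun c => 2 * |C 0| * c) (by fun_prop) (by simp)
        (by linarith : (0 : ℝ) < (μ + 4 - e₀) / 2)).and <|
      (eventually_nhdsGT_le_of_continuous (f := fun c => 2 * (2 * |C 1| * c ^ 2)) (by fun_prop) (by simp)
        (by positivity : (0 : ℝ) < 2 / π * Real.sqrt ((μ + 4 - e₀) / 2)))).and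
      eventually_mem_nhdsWithin).exists
  exact ⟨c₀, hc₀pos, hK₀, hK₁, hK₂', by linarith, hgap', hδ₁⟩

/-- The Fermi point of the sector centre lies in the open disc `|pᵢ| < π/4`. [cite: BenfattoGiulianiMastropietro2006, §2.4 Lemma 2.1 (1) p0009:L44–L50] -/
theorem abs_fermiPoint_apply_lt (hI : BGMInitial E) (hS : BGMSmoothness β U C hβ E) (hh₁ : hβ ≤ h) (hh₀ : h ≤ 0)
    (hU : |U| ≤ c₀) (hUh : |U| * |(hβ : ℝ)| ≤ c₀) (he : 0 < e₀)
    (hgap : μ + e₀ + 2 * |C 0| * c₀ < -2 - Real.sqrt 2) (hgap' : 2 * |C 0| * c₀ ≤ (μ + 4 - e₀) / 2) (he4 : e₀ < μ + 4)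
    (hδ₁ : 2 * (2 * |C 1| * c₀ ^ 2) ≤ 2 / π * Real.sqrt ((μ + 4 - e₀) / 2)) (θ₀ : ℝ) (i : Fin 2) :
    |(levelRadius (bgmEffDisp β E h) μ θ₀ • dir θ₀) i| < π / 4 := by
  obtain ⟨hroot, -, hult, -, -, -⟩ := fermiCurve_data hI hS hh₁ hh₀ hU hUh he hgap hgap' he4 hδ₁ θ₀
  rw [Pi.smul_apply, smul_eq_mul, abs_mul, abs_of_nonneg hroot.1.1]
  calc levelRadius (bgmEffDisp β E h) μ θ₀ * |dir θ₀ i| ≤ levelRadius (bgmEffDisp β E h) μ θ₀ * 1 :=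
        mul_le_mul_of_nonneg_left (abs_dir_le_one θ₀ i) hroot.1.1
    _ < π / 4 := by rw [mul_one]; exact hult

/-- **The anisotropic support package for Lemma 2.2 (decay bound (2.52)), every scale, uniformly in `β`.**
For `-4 < μ < -2-√2`... precisely: for `-4 < μ`, admissible `e₀` and the constants `C` of (2.36) there are
`c₀ > 0` and `B₁, B₂, B₃ ≥ 0` such that under `E_0 ≡ ε₀`, (2.36a), (2.36) with `|U| ≤ c₀`, `|U||h_β| ≤ c₀`,
for every scale `h_β ≤ h ≤ 0`, sector `ω` (anisotropic index `n = -h`, centre `θ₀ = θ_{h,ω}`, Fermi point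
`p⃗_F = p⃗_F^{(h)}(θ₀) = u_h(θ₀,0)e⃗_r(θ₀)`, frame `n⃗ = n⃗_h(θ₀)`, `τ⃗ = τ⃗_h(θ₀)` of (2.47)), frequency
`k₀ = k₀(j)` and momentum `k⃗' ∈ [-π,π]²` (the integration variable of (2.49)) with
`F_{h,ω}(k₀, k⃗' + p⃗_F) ≠ 0`:
(a) the frequency is in the support, `|k₀| < 8e₀γ^h`; (b) **the box (2.46)**: `|k⃗'|₁ ≤ B₂γ^{h/2}`,
`|k'₁| = |k⃗'·n⃗| ≤ B₁γ^h`, `|k'₂| = |k⃗'·τ⃗| ≤ B₂γ^{h/2}`; (c) **(2.53)–(2.54)**: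
`|∂_{k'₂}ε_h(k⃗' + p⃗_F)| ≤ B₃γ^{h/2}` and `‖∂_{k'₂}E_{h'}(k₀, k⃗' + p⃗_F)‖ ≤ B₃γ^{h/2}` for `h' = h` and
`h' = h - 1` (the two dispersions inside `f_h` and the denominator of (2.49)).  Here `γ^h = 4^h`,
`γ^{h/2} = 2^h`. [cite: BenfattoGiulianiMastropietro2006, §2.5 (2.46)–(2.47) p0010:L55–L67 and proof of Lemma 2.2 (2.53)–(2.54) p0010:L129–L154] -/
theorem aniso_support_package (hμ₁ : -4 < μ) (he₀ : BGMAdmissibleE0 μ e₀) (C : ℕ → ℝ) :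
    ∃ c₀ B₁ B₂ B₃ : ℝ, 0 < c₀ ∧ 0 ≤ B₁ ∧ 0 ≤ B₂ ∧ 0 ≤ B₃ ∧
    ∀ (β U : ℝ) (hβ : ℤ), 0 < β → hβ ≤ 0 → |U| ≤ c₀ → |U| * |(hβ : ℝ)| ≤ c₀ →
    ∀ E : ℤ → ℝ × (Fin 2 → ℝ) → ℂ, BGMInitial E → BGMSymmetry E → BGMSmoothness β U C hβ E →
    ∀ h : ℤ, hβ ≤ h → h ≤ 0 → ∀ (ω : ℕ) (j : ℤ) (k : Fin 2 → ℝ), k ∈ zoneSq →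
      bgmSectorFn e₀ μ E h (bgmScaleIdx h) ω
        (fermiMatsubara β j, k + levelRadius (bgmEffDisp β E h) μ (sectorCenter (bgmScaleIdx h) ω) •
          dir (sectorCenter (bgmScaleIdx h) ω)) ≠ 0 →
      |fermiMatsubara β j| < 8 * e₀ * (4 : ℝ) ^ h ∧
      |k 0| + |k 1| ≤ B₂ * (2 : ℝ) ^ h ∧
      |dot2 k (polarNormal (levelRadius (bgmEffDisp β E h) μ) (sectorCenter (bgmScaleIdx h) ω))| ≤ B₁ * (4 : ℝ) ^ h ∧
      |dot2 k (polarTangent (levelRadius (bgmEffDisp β E h) μ) (sectorCenter (bgmScaleIdx h) ω))| ≤ B₂ * (2 : ℝ) ^ h ∧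
      |fderiv ℝ (bgmEffDisp β E h)
          (k + levelRadius (bgmEffDisp β E h) μ (sectorCenter (bgmScaleIdx h) ω) • dir (sectorCenter (bgmScaleIdx h) ω))
          (polarTangent (levelRadius (bgmEffDisp β E h) μ) (sectorCenter (bgmScaleIdx h) ω))| ≤ B₃ * (2 : ℝ) ^ h ∧
      (∀ h' : ℤ, h' = h ∨ h' = h - 1 →
        ‖fderiv ℝ (fun q => E h' (fermiMatsubara β j, q))
          (k + levelRadius (bgmEffDisp β E h) μ (sectorCenter (bgmScaleIdx h) ω) • dir (sectorCenter (bgmScaleIdx h) ω))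
          (polarTangent (levelRadius (bgmEffDisp β E h) μ) (sectorCenter (bgmScaleIdx h) ω))‖ ≤ B₃ * (2 : ℝ) ^ h) := by
  obtain ⟨he, he2, he4⟩ := he₀
  have hπ := Real.pi_pos
  obtain ⟨c₀, hc₀pos, hK₀, hK₁, hK₂', hgap, hgap', hδ₁⟩ := exists_coupledSmallness ⟨he, he2, he4⟩ C
  set c' := Real.sqrt ((μ + 4 - e₀) / 2) with hc'
  have hc'0 : 0 < c' := Real.sqrt_pos.2 (by linarith)
  -- the constants
  set W₀ := (1 + 32 * |C 1| * c₀ ^ 2) * e₀ with hW₀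
  set L := π * (2 + 2 * |C 1| * c₀ ^ 2) / (2 / π * c') with hL
  set B₂ := 2 * (π / (2 * c') * W₀) + 2 * (L + π / 4) * (3 * π / 4) with hB₂
  set B₁ := (W₀ + (2 + |C 2| * c₀ ^ 2) * B₂ ^ 2) / (2 / π * c') with hB₁
  set B₃ := 2 * (2 + |C 2| * c₀ ^ 2) * B₂ + 2 * ((96 * e₀ * |C 2| + |C 1|) * c₀ ^ 2) with hB₃
  have hW₀0 : 0 ≤ W₀ := by positivity
  have hL0 : 0 ≤ L := by positivity
  have hB₂0 : 0 ≤ B₂ := by positivity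
  have hB₁0 : 0 ≤ B₁ := by positivity
  have hB₃0 : 0 ≤ B₃ := by positivity
  refine ⟨c₀, B₁, B₂, B₃, hc₀pos, hB₁0, hB₂0, hB₃0, ?_⟩
  intro β U hβ hβpos hhβ hU hUh E hI hSy hS h hh₁ hh₀ ω j k hk hF
  have h4 : (0 : ℝ) < (4 : ℝ) ^ h := zpow_pos (by norm_num) _
  have h2 : (0 : ℝ) < (2 : ℝ) ^ h := zpow_pos (by norm_num) _
  have h42 := four_zpow_le_two_zpow hh₀
  have h4sq := four_zpow_eq_two_zpow_sq h
  set n := bgmScaleIdx h with hn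
  set θ₀ := sectorCenter n ω with hθ₀
  set pF := levelRadius (bgmEffDisp β E h) μ θ₀ • dir θ₀ with hpF
  set q := k + pF with hq
  have hkq : k = q - pF := by rw [hq]; abel
  -- the shifted point lies in the disc `|q| < π/4 < 3π/4`
  have hpFi : ∀ i, |pF i| < π / 4 := abs_fermiPoint_apply_lt hI hS hh₁ hh₀ hU hUh he hgap hgap' he4 hδ₁ θ₀
  have hqp : q - pF ∈ zoneSq := by rw [← hkq]; exact hk
  have hf : bgmShell e₀ μ E h (fermiMatsubara β j, q) ≠ 0 := left_ne_zero_of_mul hF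
  have hball : q 0 ^ 2 + q 1 ^ 2 < (3 * π / 4) ^ 2 :=
    (sq_add_sq_lt_of_bgmShell_ne_zero_of_sub_mem hI hS he hh₁ hh₀ hU hUh hμ₁ hK₀ hgap hpFi hqp hf).trans
      (by nlinarith [Real.pi_pos])
  -- the box and the support data
  obtain ⟨hS₁, hN⟩ := box_of_support hI hSy hS he hβpos hh₁ hh₀ hU hUh hμ₁ hK₀ hK₁ hK₂' hgap hgap' he4 hδ₁ hball hF
  obtain ⟨-, -, -, -, hj, -, -⟩ := support_polar hI hSy hS he hβpos hh₁ hh₀ hU hUh hμ₁ hK₀ hK₁ hK₂' hgap hgap' he4 hball hF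
  rw [← hkq] at hS₁ hN
  have hw : sectorWidth n = π * (2 : ℝ) ^ h := sectorWidth_bgmScaleIdx hh₀
  -- (b) the `ℓ¹` bound
  have hSB : |k 0| + |k 1| ≤ B₂ * (2 : ℝ) ^ h := by
    refine hS₁.trans ?_
    rw [hw]
    have e1 : 2 * (π / (2 * c') * ((1 + 32 * |C 1| * c₀ ^ 2) * (e₀ * (4 : ℝ) ^ h))) =
        2 * (π / (2 * c') * W₀) * (4 : ℝ) ^ h := by rw [hW₀]; ring
    rw [e1]
    calc 2 * (π / (2 * c') * W₀) * (4 : ℝ) ^ h + 2 * (L + π / 4) * (3 * (π * (2 : ℝ) ^ h) / 4)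
        ≤ 2 * (π / (2 * c') * W₀) * (2 : ℝ) ^ h + 2 * (L + π / 4) * (3 * (π * (2 : ℝ) ^ h) / 4) := by
          gcongr
      _ = B₂ * (2 : ℝ) ^ h := by rw [hB₂]; ring
  have hupos : 0 < levelRadius (bgmEffDisp β E h) μ θ₀ :=
    hc'0.trans_le (fermiCurve_data hI hS hh₁ hh₀ hU hUh he hgap hgap' he4 hδ₁ θ₀).2.1
  refine ⟨hj, hSB, ?_, (abs_dot2_polarTangent_le _ θ₀ hupos k).trans hSB, ?_, fun h' hh' => ?_⟩
  · -- the normal coordinate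
    refine hN.trans ?_
    have hSsq : (|k 0| + |k 1|) ^ 2 ≤ B₂ ^ 2 * (4 : ℝ) ^ h := by
      rw [h4sq, ← mul_pow]; exact pow_le_pow_left₀ (by positivity) hSB 2
    have hm0 : 0 < 2 / π * c' := by positivity
    have key : (1 + 32 * |C 1| * c₀ ^ 2) * (e₀ * (4 : ℝ) ^ h) + (2 + |C 2| * c₀ ^ 2) * (|k 0| + |k 1|) ^ 2 ≤
        (W₀ + (2 + |C 2| * c₀ ^ 2) * B₂ ^ 2) * (4 : ℝ) ^ h := by
      have e1 : (1 + 32 * |C 1| * c₀ ^ 2) * (e₀ * (4 : ℝ) ^ h) = W₀ * (4 : ℝ) ^ h := by rw [hW₀]; ring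
      rw [e1]
      calc W₀ * (4 : ℝ) ^ h + (2 + |C 2| * c₀ ^ 2) * (|k 0| + |k 1|) ^ 2
          ≤ W₀ * (4 : ℝ) ^ h + (2 + |C 2| * c₀ ^ 2) * (B₂ ^ 2 * (4 : ℝ) ^ h) := by gcongr
        _ = (W₀ + (2 + |C 2| * c₀ ^ 2) * B₂ ^ 2) * (4 : ℝ) ^ h := by ring
    rw [hB₁]
    calc _ ≤ (W₀ + (2 + |C 2| * c₀ ^ 2) * B₂ ^ 2) * (4 : ℝ) ^ h / (2 / π * c') :=
          div_le_div_of_nonneg_right key hm0.le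
      _ = _ := by ring
  · -- (2.53) for `ε_h`
    have hε := abs_fderiv_bgmEffDisp_polarTangent_le hI hS hh₁ hh₀ hU hUh he hgap hgap' he4 hδ₁ θ₀ q
    rw [← hkq] at hε
    refine hε.trans ?_
    have h41 : (4 : ℝ) ^ h ≤ (2 : ℝ) ^ h := h42
    calc 2 * (2 + |C 2| * c₀ ^ 2) * (|k 0| + |k 1|) ≤ 2 * (2 + |C 2| * c₀ ^ 2) * (B₂ * (2 : ℝ) ^ h) := by gcongr
      _ ≤ 2 * (2 + |C 2| * c₀ ^ 2) * (B₂ * (2 : ℝ) ^ h) + 2 * ((96 * e₀ * |C 2| + |C 1|) * c₀ ^ 2) * (2 : ℝ) ^ h := by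
          have : 0 ≤ 2 * ((96 * e₀ * |C 2| + |C 1|) * c₀ ^ 2) * (2 : ℝ) ^ h := by positivity
          linarith
      _ = B₃ * (2 : ℝ) ^ h := by rw [hB₃]; ring
  · -- (2.53) for the slices
    have hsl := norm_fderiv_slice_polarTangent_le hI hSy hS he hβpos hh₁ hh₀ hU hUh hμ₁ hK₀ hK₁ hK₂' hgap hgap' he4
      hδ₁ hh' hball hF θ₀
    rw [← hkq] at hsl
    refine hsl.trans ?_
    calc 2 * (2 + |C 2| * c₀ ^ 2) * (|k 0| + |k 1|) + 2 * ((96 * e₀ * |C 2| + |C 1|) * c₀ ^ 2 * (4 : ℝ) ^ h)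
        ≤ 2 * (2 + |C 2| * c₀ ^ 2) * (B₂ * (2 : ℝ) ^ h) + 2 * ((96 * e₀ * |C 2| + |C 1|) * c₀ ^ 2 * (2 : ℝ) ^ h) := by
          gcongr
      _ = B₃ * (2 : ℝ) ^ h := by rw [hB₃]; ring

end Package

end Literature.MathematicalPhysics.QuantumLattice.FermiRG
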